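import Literature.Barriers.AtomisticToContinuum.DisorderedHarmonicChainPotential
import Mathlib.MeasureTheory.Function.JacobianOneDim
import Mathlib.MeasureTheory.Integral.IntervalIntegral.Periodic
import Mathlib.Analysis.SpecialFunctions.Trigonometric.ArctanDeriv
import Mathlib.Analysis.Calculus.Deriv.MeanValue
import HarnessLib

/-!
# Ajanki–Huveneers 2011, Lemma 5.4: the `L¹` estimate on `R_y` and the `L^∞` bound on `T` (discharge)

Sibling of `DisorderedHarmonicChainPotential.lean`; provefact unit for the named fact
`AjankiHuveneers2011_RyL1Estimate` (Lemma 5.4, eqs. (5.14)–(5.15) of O. Ajanki, F. Huveneers,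
CMP **301** (2011) 841–883, arXiv:1003.1076, p. 16 of the arXiv version).

## The printed proof and the route taken here

The paper writes `Tu(x) = ∫ t(x,z) u(z) dz`, `T_y u(x) = ∫ t_y(x,z) u(z) dz` with kernels obtained
from the changes of variables `z = F_x(b) := f_b(x)` and `z = G_x(b) := g_b(x,y)`, which are
admissible because `∂_b F_x(b) ≳ w` when `|y|_𝕋 ≥ ε` and `x` is `𝒪(w)`-close to `y`; (5.15) is then
`|t| ≲ w⁻¹`, and (5.14) is `∫ |t(x,z) - t_y(x,z)| dx = 𝒪(w)` uniformly in `z`, from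
`|F_x⁻¹ - G_x⁻¹| = 𝒪(w)`, `τ ∈ C¹[b₋,b₊]` and `Leb(D₁ Δ D₂) = 𝒪(w²)`.

We follow the same mechanism with one simplification that avoids inverse functions: since
`tan πΦ(x,b) = A_x b / (q - E_x b)` is a Möbius function of `b` (`A_x = πw sin²πx`,
`E_x = (πw/2) sin 2πx`, `q = √(1-(πw/2)²)`), the reparametrisation `b = ρ_x(b')`,
`ρ_x(b') = q A_y b' / (q A_x + γ b')`, `γ = E_x A_y - A_x E_y`, satisfies EXACTLY
`Φ(x, ρ_x(b')) = Φ(y, b')`, i.e. `F_x(ρ_x(b')) = G_x(b')`. Hence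
`R_y u(x) = ∫ u(G_x(b')) Δ_x(b') db'` with
`Δ_x = ρ_x' (1 + w h(x) ρ_x) τ∘ρ_x - (1 + w h(y)·) τ`, and `|Δ_x(b')| ≤ C w + C' 𝟙_W(b')` where `W` is
the union of the two `𝒪(w)`-windows around `b₋`, `b₊` (there `τ` may jump) — this uses
`|ρ_x(b') - b'|, |ρ_x'(b') - 1| = 𝒪(w)` for `|x - y| = 𝒪(w)`, `sin²πy ≳ ε²`, the Lipschitz bounds on
`τ` (from `τ ∈ C¹`) and on `h`. Integrating in `x` over one period and exchanging the integrals
(Tonelli), `∫ u(x + ϑ + Φ(y,b')) dx = ‖u‖₁` for every `b'`, whence `‖R_y u‖₁ ≤ ‖u‖₁ ∫ (Cw + C'𝟙_W)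
= 𝒪(w) ‖u‖₁`. For (5.15): `Tu(x) ≤ 2‖τ‖_∞ ∫ u(x + ϑ + Φ(x,b)) db ≤ (6‖τ‖_∞ / (w ε²)) ∫ ∂_bΦ(x,b)
u(x + ϑ + Φ(x,b)) db = (6‖τ‖_∞/(wε²)) ∫_{Φ(x,[b₋,b₊])} u(x + ϑ + z) dz ≤ (6‖τ‖_∞/(wε²)) ‖u‖₁`,
using `∂_b Φ(x,b) = w sin²(πx) q / (D² + N²) ≥ w sin²(πx)/3` and `sin²πx ≥ ε²` on the support of `Tu`.

Source: O. Ajanki, F. Huveneers, arXiv:1003.1076, §5, Lemma 5.4 and its proof (p. 16).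
-/

noncomputable section

open MeasureTheory Set Real

namespace Literature.Barriers.AtomisticToContinuum.HeatConduction

/-! ### The `b`-derivative of `Φ(x, b)` -/

/-- `q = √(1 - (πw/2)²)`, the constant term of the denominator of (3.10). [cite: AjankiHuveneers2011, Lemma 3.2 eq. (3.10)] -/
def ahSqrtQ (w : ℝ) : ℝ := Real.sqrt (1 - (π * w / 2) ^ 2)

/-- `A_x = πw sin²(πx)`, the `b`-slope of the numerator `N(b) = A_x b` of (3.10). [cite: AjankiHuveneers2011, Lemma 3.2 eq. (3.10)] -/
def ahNumSlope (w x : ℝ) : ℝ := π * w * Real.sin (π * x) ^ 2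

/-- `E_x = (πw/2) sin(2πx)`, minus the `b`-slope of the denominator `D(b) = q - E_x b` of (3.10).
[cite: AjankiHuveneers2011, Lemma 3.2 eq. (3.10)] -/
def ahDenSlope (w x : ℝ) : ℝ := π * w / 2 * Real.sin (2 * π * x)

/-- `∂_b Φ(x, b) = A_x q / (π (D² + N²))` (`= w sin²(πx) (1 + 𝒪(w))`). [cite: AjankiHuveneers2011, proof of Lemma 5.4] -/
def ahPhiDb (w x b : ℝ) : ℝ :=
  ahNumSlope w x * ahSqrtQ w / (π * (ahDen w x b ^ 2 + ahNum w x b ^ 2))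

/-- `N(b) = A_x b`. [cite: AjankiHuveneers2011, Lemma 3.2 eq. (3.10)] -/
theorem ahNum_eq_slope_mul (w x b : ℝ) : ahNum w x b = ahNumSlope w x * b := by
  rw [ahNum_eq]; unfold ahNumSlope; ring

/-- `D(b) = q - E_x b`. [cite: AjankiHuveneers2011, Lemma 3.2 eq. (3.10)] -/
theorem ahDen_eq_sub_slope_mul (w x b : ℝ) : ahDen w x b = ahSqrtQ w - ahDenSlope w x * b := by
  unfold ahDen ahSqrtQ ahDenSlope; ring

/-- `A_x ≥ 0`. [folklore] -/
theorem ahNumSlope_nonneg {w : ℝ} (hw : 0 ≤ w) (x : ℝ) : 0 ≤ ahNumSlope w x := by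
  unfold ahNumSlope; positivity

/-- `A_x ≤ πw`. [folklore] -/
theorem ahNumSlope_le {w : ℝ} (hw : 0 ≤ w) (x : ℝ) : ahNumSlope w x ≤ π * w := by
  unfold ahNumSlope
  have := Real.sin_sq_le_one (π * x)
  have h0 : 0 ≤ π * w := by positivity
  nlinarith

/-- `|E_x| ≤ πw/2`. [folklore] -/
theorem abs_ahDenSlope_le {w : ℝ} (hw : 0 ≤ w) (x : ℝ) : |ahDenSlope w x| ≤ π * w / 2 := by
  unfold ahDenSlope
  rw [abs_mul, abs_of_nonneg (by positivity : (0 : ℝ) ≤ π * w / 2)]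
  exact mul_le_of_le_one_right (by positivity) (Real.abs_sin_le_one _)

/-- **`∂_b Φ(x,b)`**: `HasDerivAt (Φ(x, ·)) (A_x q / (π(D² + N²))) b` wherever `D ≠ 0`. [cite: AjankiHuveneers2011, proof of Lemma 5.4] -/
theorem hasDerivAt_ahPhi_right (w x b : ℝ) (hD : ahDen w x b ≠ 0) :
    HasDerivAt (fun b => ahPhi w x b) (ahPhiDb w x b) b := by
  have hN : HasDerivAt (fun b => ahNum w x b) (ahNumSlope w x) b := by
    have : (fun b => ahNum w x b) = fun b => ahNumSlope w x * b := funext (ahNum_eq_slope_mul w x)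
    rw [this]
    simpa using (hasDerivAt_id b).const_mul (ahNumSlope w x)
  have hD' : HasDerivAt (fun b => ahDen w x b) (-ahDenSlope w x) b := by
    have : (fun b => ahDen w x b) = fun b => ahSqrtQ w - ahDenSlope w x * b :=
      funext (ahDen_eq_sub_slope_mul w x)
    rw [this]
    simpa using ((hasDerivAt_id b).const_mul (ahDenSlope w x)).const_sub (ahSqrtQ w)
  have hq : HasDerivAt (fun b => ahNum w x b / ahDen w x b)
      ((ahNumSlope w x * ahDen w x b - ahNum w x b * -ahDenSlope w x) / ahDen w x b ^ 2) b := by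
    have := hN.div hD' hD
    simpa only [Pi.div_def] using this
  have h1 : HasDerivAt (fun b => ahPhi w x b)
      (1 / (1 + (ahNum w x b / ahDen w x b) ^ 2) *
        ((ahNumSlope w x * ahDen w x b - ahNum w x b * -ahDenSlope w x) / ahDen w x b ^ 2) / π) b :=
    (hq.arctan).div_const π
  refine h1.congr_deriv ?_
  unfold ahPhiDb
  have hND : ahNumSlope w x * ahDen w x b - ahNum w x b * -ahDenSlope w x =
      ahNumSlope w x * ahSqrtQ w := by
    rw [ahNum_eq_slope_mul, ahDen_eq_sub_slope_mul]; ring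
  rw [hND]
  have hD2 : ahDen w x b ^ 2 ≠ 0 := pow_ne_zero 2 hD
  field_simp

/-- Bounds on `q`, `D`, `N` in the regime `πw(1 + |b|) ≤ 1/2`: `3/4 ≤ q ≤ 1`, `1/2 ≤ D ≤ 5/4`,
`|N| ≤ 1/2`. [folklore] -/
theorem ahQDN_bounds {w b : ℝ} (hw : 0 ≤ w) (hwb : π * w * (1 + |b|) ≤ 1 / 2) (x : ℝ) :
    3 / 4 ≤ ahSqrtQ w ∧ ahSqrtQ w ≤ 1 ∧ 1 / 2 ≤ ahDen w x b ∧ ahDen w x b ≤ 5 / 4 ∧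
      |ahNum w x b| ≤ 1 / 2 := by
  have hπw : 0 ≤ π * w := by positivity
  have hπw1 : π * w ≤ 1 / 2 := by nlinarith [abs_nonneg b]
  have hπwb : π * w * |b| ≤ 1 / 2 := by nlinarith [abs_nonneg b]
  have hq_lo : 3 / 4 ≤ ahSqrtQ w := by
    unfold ahSqrtQ
    rw [Real.le_sqrt (by norm_num) (by nlinarith)]
    nlinarith
  have hq_hi : ahSqrtQ w ≤ 1 := by
    unfold ahSqrtQ
    rw [Real.sqrt_le_one]
    nlinarith [sq_nonneg (π * w / 2)]
  have hE : |ahDenSlope w x * b| ≤ 1 / 4 := by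
    rw [abs_mul]
    calc |ahDenSlope w x| * |b| ≤ π * w / 2 * |b| :=
          mul_le_mul_of_nonneg_right (abs_ahDenSlope_le hw x) (abs_nonneg b)
      _ ≤ 1 / 4 := by linarith
  have hN : |ahNum w x b| ≤ 1 / 2 := by
    rw [ahNum_eq_slope_mul, abs_mul, abs_of_nonneg (ahNumSlope_nonneg hw x)]
    calc ahNumSlope w x * |b| ≤ π * w * |b| :=
          mul_le_mul_of_nonneg_right (ahNumSlope_le hw x) (abs_nonneg b)
      _ ≤ 1 / 2 := hπwb
  refine ⟨hq_lo, hq_hi, ?_, ?_, hN⟩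
  · rw [ahDen_eq_sub_slope_mul]; linarith [le_abs_self (ahDenSlope w x * b)]
  · rw [ahDen_eq_sub_slope_mul]; linarith [neg_abs_le (ahDenSlope w x * b)]

/-- **`∂_b Φ(x,b) ≍ w sin²(πx)`**: `w sin²(πx)/3 ≤ ∂_bΦ(x,b) ≤ 4 w sin²(πx)` for `πw(1+|b|) ≤ 1/2`.
[cite: AjankiHuveneers2011, proof of Lemma 5.4] -/
theorem ahPhiDb_bounds {w b : ℝ} (hw : 0 ≤ w) (hwb : π * w * (1 + |b|) ≤ 1 / 2) (x : ℝ) :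
    w * Real.sin (π * x) ^ 2 / 3 ≤ ahPhiDb w x b ∧ ahPhiDb w x b ≤ 4 * w * Real.sin (π * x) ^ 2 := by
  obtain ⟨hq_lo, hq_hi, hD_lo, hD_hi, hN⟩ := ahQDN_bounds hw hwb x
  have hπ := Real.pi_pos
  set S2 := Real.sin (π * x) ^ 2 with hS2
  have hS2_0 : 0 ≤ S2 := sq_nonneg _
  have hA : ahNumSlope w x = π * w * S2 := rfl
  set Q := ahDen w x b ^ 2 + ahNum w x b ^ 2 with hQ
  have hQ_lo : 1 / 4 ≤ Q := by
    have : (1 / 2) ^ 2 ≤ ahDen w x b ^ 2 := pow_le_pow_left₀ (by norm_num) hD_lo 2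
    nlinarith [sq_nonneg (ahNum w x b)]
  have hQ_hi : Q ≤ 2 := by
    have h1 : ahDen w x b ^ 2 ≤ (5 / 4) ^ 2 := pow_le_pow_left₀ (by linarith) hD_hi 2
    have h2 : ahNum w x b ^ 2 ≤ (1 / 2) ^ 2 := by
      rw [← sq_abs]; exact pow_le_pow_left₀ (abs_nonneg _) hN 2
    nlinarith
  have hQ0 : 0 < Q := by linarith
  unfold ahPhiDb
  rw [← hQ, hA]
  have hden : 0 < π * Q := by positivity
  constructor
  · rw [div_le_div_iff₀ (by norm_num : (0 : ℝ) < 3) hden]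
    have : w * S2 * (π * Q) ≤ w * S2 * (π * 2) := by gcongr
    nlinarith [mul_nonneg (mul_nonneg hw hS2_0) hπ.le]
  · rw [div_le_iff₀ hden]
    have h1 : π * w * S2 * ahSqrtQ w ≤ π * w * S2 * 1 := by gcongr
    have h2 : 4 * w * S2 * (π * (1 / 4)) ≤ 4 * w * S2 * (π * Q) := by gcongr
    nlinarith

/-- `b ↦ Φ(x, b)` is injective on any set where the denominators are non-zero, as soon as
`sin πx ≠ 0` and `q ≠ 0` (`tan πΦ` is a Möbius function of `b`). [folklore] -/
theorem ahPhi_right_injOn {w x : ℝ} {J : Set ℝ} (hA : ahNumSlope w x ≠ 0) (hq : ahSqrtQ w ≠ 0)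
    (hD : ∀ b ∈ J, ahDen w x b ≠ 0) : InjOn (fun b => ahPhi w x b) J := by
  intro b₁ h₁ b₂ h₂ h
  have h' : Real.arctan (ahNum w x b₁ / ahDen w x b₁) = Real.arctan (ahNum w x b₂ / ahDen w x b₂) := by
    unfold ahPhi at h
    exact (div_left_inj' Real.pi_pos.ne').mp h
  have h'' := Real.arctan_injective h'
  rw [div_eq_div_iff (hD b₁ h₁) (hD b₂ h₂), ahNum_eq_slope_mul, ahNum_eq_slope_mul,
    ahDen_eq_sub_slope_mul, ahDen_eq_sub_slope_mul] at h''
  have h3 : ahNumSlope w x * ahSqrtQ w * (b₁ - b₂) = 0 := by linear_combination h''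
  rcases mul_eq_zero.mp h3 with h4 | h4
  · exact absurd h4 (mul_ne_zero hA hq)
  · linarith

/-! ### Plumbing: Jordan's inequality on `𝕋`, Lipschitz bounds, period integrals -/

/-- `|y|_𝕋 ≥ ε` forces `|sin πy| ≥ 2ε` (Jordan's inequality). [folklore] -/
theorem two_mul_le_abs_sin_pi {y ε : ℝ} (hy : ∀ k : ℤ, ε ≤ |y - k|) :
    2 * ε ≤ |Real.sin (π * y)| := by
  have ht1 : |y - round y| ≤ 1 / 2 := abs_sub_round y
  have ht2 : ε ≤ |y - round y| := hy (round y)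
  set t := y - round y with ht
  have hsin : |Real.sin (π * y)| = |Real.sin (π * t)| := by
    have : π * y = π * t + (round y : ℝ) * π := by rw [ht]; ring
    rw [this, Real.sin_add_int_mul_pi, abs_mul, abs_neg_one_zpow, one_mul]
  rw [hsin]
  have h0 : 0 ≤ π * |t| := by positivity
  have h1 : π * |t| ≤ π / 2 := by nlinarith [Real.pi_pos]
  have h2 := Real.mul_le_sin h0 h1
  have h3 : 2 / π * (π * |t|) = 2 * |t| := by field_simp
  rw [h3] at h2
  have h4 : Real.sin (π * |t|) ≤ |Real.sin (π * t)| := by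
    rcases le_or_gt 0 t with h | h
    · rw [abs_of_nonneg h]; exact le_abs_self _
    · rw [abs_of_neg h, mul_neg, Real.sin_neg]; exact neg_le_abs _
  linarith

/-- `τ` is Lipschitz on `[b₋, b₊]` (`τ ∈ C¹([b₋,b₊])`). [cite: AjankiHuveneers2011, §2 ¶1] -/
theorem ReducedLawHyp.exists_lipschitz {τ : ℝ → ℝ} {bm bp : ℝ} (hτ : ReducedLawHyp τ bm bp) :
    ∃ L : ℝ, 0 ≤ L ∧ ∀ b₁ ∈ Icc bm bp, ∀ b₂ ∈ Icc bm bp, |τ b₁ - τ b₂| ≤ L * |b₁ - b₂| := by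
  obtain ⟨C, hC⟩ := hτ.deriv_bound
  refine ⟨max C 0, le_max_right _ _, ?_⟩
  suffices key : ∀ b₁ ∈ Icc bm bp, ∀ b₂ ∈ Icc bm bp, b₁ < b₂ →
      |τ b₁ - τ b₂| ≤ max C 0 * |b₁ - b₂| by
    intro b₁ h₁ b₂ h₂
    rcases lt_trichotomy b₁ b₂ with h | h | h
    · exact key b₁ h₁ b₂ h₂ h
    · subst h; simp
    · rw [abs_sub_comm, abs_sub_comm b₁ b₂]; exact key b₂ h₂ b₁ h₁ h
  intro b₁ h₁ b₂ h₂ hlt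
  have hcont : ContinuousOn τ (Icc b₁ b₂) := hτ.continuousOn.mono (Icc_subset_Icc h₁.1 h₂.2)
  have hdiff : DifferentiableOn ℝ τ (Ioo b₁ b₂) :=
    (hτ.contDiffOn.differentiableOn one_ne_zero).mono (Ioo_subset_Ioo h₁.1 h₂.2)
  obtain ⟨c, hc, hceq⟩ := exists_deriv_eq_slope τ hlt hcont hdiff
  have hcI : c ∈ Ioo bm bp := ⟨lt_of_le_of_lt h₁.1 hc.1, lt_of_lt_of_le hc.2 h₂.2⟩
  have hb := hC c hcI
  have hne : b₂ - b₁ ≠ 0 := sub_ne_zero.mpr hlt.ne'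
  have : τ b₁ - τ b₂ = -(deriv τ c * (b₂ - b₁)) := by rw [hceq]; field_simp; ring
  rw [this, abs_neg, abs_mul, abs_sub_comm b₂ b₁]
  exact mul_le_mul_of_nonneg_right (hb.trans (le_max_left _ _)) (abs_nonneg _)

/-- A `1`-periodic `C¹` function is bounded and Lipschitz. [folklore] -/
theorem periodic_contDiff_bounds {h : ℝ → ℝ} (hp : Function.Periodic h 1) (hd : ContDiff ℝ 1 h) :
    ∃ H L : ℝ, 0 ≤ H ∧ 0 ≤ L ∧ (∀ x, |h x| ≤ H) ∧ ∀ x y, |h x - h y| ≤ L * |x - y| := by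
  have hc : Continuous h := hd.continuous
  have hdiff : Differentiable ℝ h := hd.differentiable one_ne_zero
  have hc' : Continuous (deriv h) := hd.continuous_deriv le_rfl
  have hp' : Function.Periodic (deriv h) 1 := by
    intro x
    have h1 : deriv (fun z => h (z + 1)) x = deriv h (x + 1) := deriv_comp_add_const ..
    rw [← h1]
    congr 1
    funext z
    exact hp z
  have reduce : ∀ g : ℝ → ℝ, Function.Periodic g 1 → ∀ x, ∃ z ∈ Icc (0 : ℝ) 1, g x = g z := by
    intro g hg x
    refine ⟨Int.fract x, ⟨Int.fract_nonneg x, (Int.fract_lt_one x).le⟩, ?_⟩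
    have h1 := (hg.int_mul ⌊x⌋) (Int.fract x)
    rw [mul_one, Int.fract_add_floor] at h1
    exact h1
  obtain ⟨H, hH⟩ := isCompact_Icc.exists_bound_of_continuousOn (hc.continuousOn (s := Icc (0 : ℝ) 1))
  obtain ⟨L, hL⟩ := isCompact_Icc.exists_bound_of_continuousOn (hc'.continuousOn (s := Icc (0 : ℝ) 1))
  have hH' : ∀ x, |h x| ≤ max H 0 := by
    intro x
    obtain ⟨z, hz, hxz⟩ := reduce h hp x
    rw [hxz]
    exact ((Real.norm_eq_abs _).symm.le.trans (hH z hz)).trans (le_max_left _ _)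
  have hL' : ∀ x, ‖deriv h x‖ ≤ max L 0 := by
    intro x
    obtain ⟨z, hz, hxz⟩ := reduce (deriv h) hp' x
    rw [hxz]
    exact (hL z hz).trans (le_max_left _ _)
  refine ⟨max H 0, max L 0, le_max_right _ _, le_max_right _ _, hH', fun x y => ?_⟩
  have := Convex.norm_image_sub_le_of_norm_deriv_le (fun z _ => hdiff z) (fun z _ => hL' z)
    convex_univ (mem_univ y) (mem_univ x)
  simpa only [Real.norm_eq_abs] using this

/-- The integral of a `1`-periodic function over a period `(a, a+1]` does not depend on `a`. [folklore] -/
theorem periodic_setIntegral_Ioc {v : ℝ → ℝ} (hv : Function.Periodic v 1) (a : ℝ) :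
    ∫ x in Ioc a (a + 1), v x = ∫ x in Ioc 0 1, v x := by
  rw [← intervalIntegral.integral_of_le (by linarith), ← intervalIntegral.integral_of_le zero_le_one]
  have := hv.intervalIntegral_add_eq a 0
  rwa [zero_add] at this

/-- Same over `[a, a+1)`. [folklore] -/
theorem periodic_setIntegral_Ico {v : ℝ → ℝ} (hv : Function.Periodic v 1) (a : ℝ) :
    ∫ x in Ico a (a + 1), v x = ∫ x in Ico 0 1, v x := by
  rw [integral_Ico_eq_integral_Ioc, integral_Ico_eq_integral_Ioc]
  exact periodic_setIntegral_Ioc hv a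

/-- `∫_{(a, a+1]} u(x + c) dx = ‖u‖₁` for `u ≥ 0` and `1`-periodic. [folklore] -/
theorem setIntegral_Ioc_translate_eq_ahL1 {u : ℝ → ℝ} (hu : Function.Periodic u 1)
    (hu0 : ∀ x, 0 ≤ u x) (a c : ℝ) : ∫ x in Ioc a (a + 1), u (x + c) = ahL1 u := by
  have hp : Function.Periodic (fun x => u (x + c)) 1 := fun x => by
    show u (x + 1 + c) = u (x + c)
    rw [add_right_comm]; exact hu (x + c)
  rw [periodic_setIntegral_Ioc hp a]
  unfold ahL1
  rw [integral_Ico_eq_integral_Ioc, ← intervalIntegral.integral_of_le zero_le_one,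
    ← intervalIntegral.integral_of_le zero_le_one, intervalIntegral.integral_comp_add_right,
    zero_add, add_comm 1 c, hu.intervalIntegral_add_eq c 0, zero_add]
  apply intervalIntegral.integral_congr
  intro x _
  simp only [abs_of_nonneg (hu0 x)]

/-- `∫_{[a, a+1)} u(x + c) dx = ‖u‖₁` for `u ≥ 0` and `1`-periodic. [folklore] -/
theorem setIntegral_Ico_translate_eq_ahL1 {u : ℝ → ℝ} (hu : Function.Periodic u 1)
    (hu0 : ∀ x, 0 ≤ u x) (a c : ℝ) : ∫ x in Ico a (a + 1), u (x + c) = ahL1 u := by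
  rw [integral_Ico_eq_integral_Ioc]; exact setIntegral_Ioc_translate_eq_ahL1 hu hu0 a c

/-- `∫_{[a, a+1]} u(x + c) dx = ‖u‖₁` for `u ≥ 0` and `1`-periodic. [folklore] -/
theorem setIntegral_Icc_translate_eq_ahL1 {u : ℝ → ℝ} (hu : Function.Periodic u 1)
    (hu0 : ∀ x, 0 ≤ u x) (a c : ℝ) : ∫ x in Icc a (a + 1), u (x + c) = ahL1 u := by
  rw [integral_Icc_eq_integral_Ioc]; exact setIntegral_Ioc_translate_eq_ahL1 hu hu0 a c

/-- `‖u‖₁ ≥ 0`. [folklore] -/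
theorem ahL1_nonneg (u : ℝ → ℝ) : 0 ≤ ahL1 u := integral_nonneg fun _ => abs_nonneg _

/-- A bounded Borel function is integrable on `[a, b]`. [folklore] -/
theorem integrableOn_Icc_of_bound {f : ℝ → ℝ} {a b C : ℝ} (hf : Measurable f)
    (hC : ∀ x ∈ Icc a b, |f x| ≤ C) : IntegrableOn f (Icc a b) := by
  refine Measure.integrableOn_of_bounded (M := C) measure_Icc_lt_top.ne hf.aestronglyMeasurable ?_
  exact ae_restrict_of_forall_mem measurableSet_Icc fun x hx => by
    rw [Real.norm_eq_abs]; exact hC x hx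

/-! ### Eq. (5.15): `‖Tu‖_∞ ≤ K' w⁻¹ ‖u‖₁` -/

/-- **(5.15) with explicit constants.** For `x` in the support of `Tu` one has `sin²πx ≥ ε²`, and
`Tu(x) ≤ 2‖τ‖_∞ ∫ u(x + ϑ + Φ(x,b)) db ≤ (6‖τ‖_∞/(wε²)) ∫_{Φ(x,[b₋,b₊])} u(x + ϑ + z) dz
≤ (6‖τ‖_∞/(wε²)) ‖u‖₁` by the change of variables `z = Φ(x,b)`, `∂_bΦ ≥ w sin²(πx)/3`.
[cite: AjankiHuveneers2011, Lemma 5.4 eq. (5.15)] -/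
theorem ahT_sup_bound {τ : ℝ → ℝ} {bm bp : ℝ} (hτ : ReducedLawHyp τ bm bp) {h : ℝ → ℝ}
    {H : ℝ} (hH : ∀ x, |h x| ≤ H) {Cτ : ℝ} (hCτ : ∀ s, |τ s| ≤ Cτ) (hCτ0 : 0 ≤ Cτ)
    {K₁ K₂ w₁ : ℝ} (hK₁ : 0 < K₁)
    (hinc : ∀ w ∈ Set.Ioc 0 w₁, ∀ x, ∀ b ∈ Icc bm bp,
      K₁ * w ≤ ahStep w b x - x ∧ ahStep w b x - x ≤ K₂ * w)
    {K ε w : ℝ} (hε : 0 < ε) (hw0 : 0 < w) (hw1 : w ≤ w₁)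
    (hwε : π * (K + K₂) * w ≤ ε) (hwb : π * w * (1 + max |bm| |bp|) ≤ 1 / 2)
    (hwH : w * H * max |bm| |bp| ≤ 1)
    {y : ℝ} (hy : ∀ k : ℤ, ε ≤ |y - k|) {u : ℝ → ℝ} (hu : AHBallFn u y (K * w)) (x : ℝ) :
    |ahT τ w h u x| ≤ 6 * Cτ / ε ^ 2 * w⁻¹ * ahL1 u := by
  have hL1 := ahL1_nonneg u
  by_cases hT : ahT τ w h u x = 0
  · rw [hT, abs_zero]; positivity
  -- `x` is `𝒪(w)`-close to `y + ℤ`, hence `sin²πx ≥ ε²`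
  obtain ⟨b₀, hb₀, hne⟩ := exists_ne_zero_of_ahT_ne_zero hτ.eq_zero hT
  obtain ⟨k, hk⟩ := hu.support _ hne
  obtain ⟨hlo, hhi⟩ := hinc w ⟨hw0, hw1⟩ x b₀ hb₀
  have hxy : |x - y - k| ≤ (K + K₂) * w := by
    have h1 : x - y - k = (ahStep w b₀ x - y - k) - (ahStep w b₀ x - x) := by ring
    rw [h1]
    have h2 := abs_lt.mp hk
    have h3 : 0 ≤ ahStep w b₀ x - x := by nlinarith
    rw [abs_le]; constructor <;> nlinarith
  have hSy : 2 * ε ≤ |Real.sin (π * (y + k))| := by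
    have : π * (y + k) = π * y + (k : ℝ) * π := by ring
    rw [this, Real.sin_add_int_mul_pi, abs_mul, abs_neg_one_zpow, one_mul]
    exact two_mul_le_abs_sin_pi hy
  have hSx : ε ≤ |Real.sin (π * x)| := by
    have h1 := Real.abs_sin_sub_sin_le (π * x) (π * (y + k))
    have h2 : |π * x - π * (y + k)| ≤ ε := by
      rw [← mul_sub, abs_mul, abs_of_pos Real.pi_pos, show x - (y + k) = x - y - k by ring]
      calc π * |x - y - k| ≤ π * ((K + K₂) * w) := mul_le_mul_of_nonneg_left hxy Real.pi_pos.le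
        _ = π * (K + K₂) * w := by ring
        _ ≤ ε := hwε
    have h3 := abs_sub_abs_le_abs_sub (Real.sin (π * (y + k))) (Real.sin (π * x))
    rw [abs_sub_comm] at h3
    linarith
  have hS2 : ε ^ 2 ≤ Real.sin (π * x) ^ 2 := by
    rw [← sq_abs (Real.sin _)]; exact pow_le_pow_left₀ hε.le hSx 2
  -- constants
  obtain ⟨M, hM⟩ := hu.bounded
  set B := max |bm| |bp| with hB
  have hB0 : 0 ≤ B := le_max_of_le_left (abs_nonneg _)
  have hbB : ∀ b ∈ Icc bm bp, |b| ≤ B := fun b hb => ReducedLawHyp.abs_le_of_mem hb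
  have hwhx : w * |h x| * max |bm| |bp| ≤ 1 := by
    calc w * |h x| * max |bm| |bp| ≤ w * H * max |bm| |bp| := by gcongr; exact hH x
      _ ≤ 1 := hwH
  have hT0 : 0 ≤ ahT τ w h u x := ahT_nonneg hτ hu.nonneg hw0.le hwhx
  rw [abs_of_nonneg hT0]
  -- measurability of the pieces
  have hmeas_uF : Measurable fun b => u (ahStep w b x) := hu.measurable.comp (measurable_ahStep_right w x)
  have hmeas_w : Measurable fun b => (1 + w * h x * b) * τ b :=
    ((measurable_const.add (measurable_const.mul measurable_id)).mul hτ.measurable)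
  -- Step 1: `Tu(x) = ∫_s u(F b) (1 + w h(x) b) τ(b) db ≤ 2 Cτ ∫_s u(F b) db`
  have hstep1 : ahT τ w h u x ≤ ∫ b in Icc bm bp, u (ahStep w b x) * (2 * Cτ) := by
    unfold ahT
    rw [← setIntegral_eq_integral_of_forall_compl_eq_zero (s := Icc bm bp) (fun b hb => by
      rw [hτ.eq_zero b hb, mul_zero, mul_zero])]
    refine setIntegral_mono_on ?_ ?_ measurableSet_Icc fun b hb => ?_
    · refine integrableOn_Icc_of_bound (hmeas_uF.mul hmeas_w) (C := M * (2 * Cτ)) fun b hb => ?_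
      rw [abs_mul, abs_of_nonneg (hu.nonneg _), abs_mul]
      refine mul_le_mul (hM _) ?_ (by positivity)
        ((hu.nonneg (ahStep w b x)).trans (hM (ahStep w b x)))
      have h1 : |1 + w * h x * b| ≤ 2 := by
        have h0 := ahWeight_nonneg (x := x) (h := h) hw0.le hwhx hb
        rw [abs_of_nonneg h0]
        have : |w * h x * b| ≤ 1 := by
          rw [abs_mul, abs_mul, abs_of_pos hw0]
          calc w * |h x| * |b| ≤ w * |h x| * B := by gcongr; exact hbB b hb
            _ ≤ 1 := hwhx
        linarith [le_abs_self (w * h x * b)]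
      calc |1 + w * h x * b| * |τ b| ≤ 2 * Cτ := mul_le_mul h1 (hCτ b) (abs_nonneg _) zero_le_two
        _ = 2 * Cτ := rfl
    · exact integrableOn_Icc_of_bound (hmeas_uF.mul measurable_const) (C := M * (2 * Cτ))
        fun b _ => by
          rw [abs_mul, abs_of_nonneg (hu.nonneg _), abs_of_nonneg (by positivity : (0:ℝ) ≤ 2 * Cτ)]
          exact mul_le_mul_of_nonneg_right (hM _) (by positivity)
    · refine mul_le_mul_of_nonneg_left ?_ (hu.nonneg _)
      have h0 := ahWeight_nonneg (x := x) (h := h) hw0.le hwhx hb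
      have h1 : 1 + w * h x * b ≤ 2 := by
        have : |w * h x * b| ≤ 1 := by
          rw [abs_mul, abs_mul, abs_of_pos hw0]
          calc w * |h x| * |b| ≤ w * |h x| * B := by gcongr; exact hbB b hb
            _ ≤ 1 := hwhx
        linarith [le_abs_self (w * h x * b)]
      calc (1 + w * h x * b) * τ b ≤ 2 * Cτ :=
          mul_le_mul h1 ((le_abs_self _).trans (hCτ b)) (hτ.nonneg b) zero_le_two
        _ = 2 * Cτ := rfl
  -- Step 2: `∫_s u(F b) db ≤ (3/(wε²)) ∫_s ∂_bΦ(x,b) u(F b) db`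
  have hwb' : ∀ b ∈ Icc bm bp, π * w * (1 + |b|) ≤ 1 / 2 := fun b hb =>
    le_trans (by gcongr; exact hbB b hb) hwb
  have hDpos : ∀ b ∈ Icc bm bp, 0 < ahDen w x b := fun b hb =>
    lt_of_lt_of_le (by norm_num) (ahQDN_bounds hw0.le (hwb' b hb) x).2.2.1
  have hstep2 : ∫ b in Icc bm bp, u (ahStep w b x) * (2 * Cτ) ≤
      ∫ b in Icc bm bp, (2 * Cτ * (3 / (w * ε ^ 2))) * (|ahPhiDb w x b| • u (x + ahTheta w + ahPhi w x b)) := by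
    refine setIntegral_mono_on ?_ ?_ measurableSet_Icc fun b hb => ?_
    · exact integrableOn_Icc_of_bound (hmeas_uF.mul measurable_const) (C := M * (2 * Cτ))
        fun b _ => by
          rw [abs_mul, abs_of_nonneg (hu.nonneg _), abs_of_nonneg (by positivity : (0:ℝ) ≤ 2 * Cτ)]
          exact mul_le_mul_of_nonneg_right (hM _) (by positivity)
    · have hmeasD : Measurable fun b => ahPhiDb w x b := by
        unfold ahPhiDb
        refine measurable_const.div (measurable_const.mul ?_)
        have h1 : Measurable fun b => ahDen w x b := by
          have : (fun b => ahDen w x b) = fun b => ahSqrtQ w - ahDenSlope w x * b :=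
            funext (ahDen_eq_sub_slope_mul w x)
          rw [this]; exact measurable_const.sub (measurable_const.mul measurable_id)
        have h2 : Measurable fun b => ahNum w x b := by
          have : (fun b => ahNum w x b) = fun b => ahNumSlope w x * b :=
            funext (ahNum_eq_slope_mul w x)
          rw [this]; exact measurable_const.mul measurable_id
        exact (h1.pow_const 2).add (h2.pow_const 2)
      refine integrableOn_Icc_of_bound (measurable_const.mul ((continuous_abs.measurable.comp hmeasD).smul hmeas_uF))
        (C := 2 * Cτ * (3 / (w * ε ^ 2)) * (4 * w * M)) fun b hb => ?_
      have hDb := (ahPhiDb_bounds hw0.le (hwb' b hb) x)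
      have hDb0 : 0 ≤ ahPhiDb w x b := le_trans (by positivity) hDb.1
      rw [smul_eq_mul, abs_mul, abs_of_nonneg (by positivity : (0:ℝ) ≤ 2 * Cτ * (3 / (w * ε ^ 2))),
        abs_mul, abs_abs, abs_of_nonneg hDb0, abs_of_nonneg (hu.nonneg _)]
      refine mul_le_mul_of_nonneg_left ?_ (by positivity)
      refine mul_le_mul (hDb.2.trans ?_) (hM _) (hu.nonneg _) (by positivity)
      have := Real.sin_sq_le_one (π * x)
      nlinarith
    · have hDb := (ahPhiDb_bounds hw0.le (hwb' b hb) x)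
      have hDb1 : w * ε ^ 2 / 3 ≤ ahPhiDb w x b := le_trans (by gcongr) hDb.1
      have hDb0 : 0 ≤ ahPhiDb w x b := le_trans (by positivity) hDb1
      rw [smul_eq_mul, abs_of_nonneg hDb0]
      change u (ahStep w b x) * (2 * Cτ) ≤ 2 * Cτ * (3 / (w * ε ^ 2)) * (ahPhiDb w x b * u (ahStep w b x))
      have hu0 := hu.nonneg (ahStep w b x)
      have hkey : 1 ≤ 3 / (w * ε ^ 2) * ahPhiDb w x b := by
        rw [div_mul_eq_mul_div, le_div_iff₀ (by positivity)]
        linarith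
      nlinarith [mul_nonneg (mul_nonneg hu0 hCτ0) (sub_nonneg.mpr hkey)]
  -- Step 3: change of variables `z = Φ(x, b)`
  have hA : ahNumSlope w x ≠ 0 := by
    unfold ahNumSlope
    have : 0 < Real.sin (π * x) ^ 2 := lt_of_lt_of_le (by positivity) hS2
    positivity
  have hq : ahSqrtQ w ≠ 0 := by
    have hb0 : bm ∈ Icc bm bp := ⟨le_rfl, hτ.lt.le⟩
    linarith [(ahQDN_bounds hw0.le (hwb' bm hb0) x).1]
  have hinj : InjOn (fun b => ahPhi w x b) (Icc bm bp) :=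
    ahPhi_right_injOn hA hq fun b hb => (hDpos b hb).ne'
  have hcv := integral_image_eq_integral_abs_deriv_smul measurableSet_Icc
    (fun b hb => (hasDerivAt_ahPhi_right w x b (hDpos b hb).ne').hasDerivWithinAt) hinj
    (fun z => u (x + ahTheta w + z))
  have hstep3 : ∫ b in Icc bm bp, (2 * Cτ * (3 / (w * ε ^ 2))) *
      (|ahPhiDb w x b| • u (x + ahTheta w + ahPhi w x b)) =
      (2 * Cτ * (3 / (w * ε ^ 2))) * ∫ z in (fun b => ahPhi w x b) '' Icc bm bp, u (x + ahTheta w + z) := by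
    rw [integral_const_mul, hcv]
  -- Step 4: `∫_{Φ(x,[b₋,b₊])} u(x + ϑ + z) dz ≤ ∫_{[-1/2,1/2]} u(x + ϑ + z) dz = ‖u‖₁`
  have hstep4 : ∫ z in (fun b => ahPhi w x b) '' Icc bm bp, u (x + ahTheta w + z) ≤ ahL1 u := by
    have heq : ∫ z in Icc (-(1 / 2) : ℝ) (-(1 / 2) + 1), u (z + (x + ahTheta w)) = ahL1 u :=
      setIntegral_Icc_translate_eq_ahL1 hu.periodic hu.nonneg _ _
    have hfun : (fun z => u (x + ahTheta w + z)) = fun z => u (z + (x + ahTheta w)) := by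
      funext z; rw [add_comm]
    rw [← heq, ← hfun]
    refine setIntegral_mono_set ?_ ?_ ?_
    · rw [hfun]
      exact integrableOn_Icc_of_bound (hu.measurable.comp (measurable_id.add_const _)) (C := M)
        fun z _ => by rw [abs_of_nonneg (hu.nonneg _)]; exact hM _
    · exact ae_of_all _ fun z => hu.nonneg _
    · refine ae_of_all _ fun z hz => ?_
      obtain ⟨b, -, rfl⟩ := hz
      have h1 := Real.arctan_lt_pi_div_two (ahNum w x b / ahDen w x b)
      have h2 := Real.neg_pi_div_two_lt_arctan (ahNum w x b / ahDen w x b)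
      simp only [ahPhi]
      constructor
      · rw [le_div_iff₀ Real.pi_pos]; linarith
      · rw [div_le_iff₀ Real.pi_pos]; linarith
  -- assembly
  calc ahT τ w h u x ≤ (2 * Cτ * (3 / (w * ε ^ 2))) *
        ∫ z in (fun b => ahPhi w x b) '' Icc bm bp, u (x + ahTheta w + z) := by
        rw [← hstep3]; exact hstep1.trans hstep2
    _ ≤ (2 * Cτ * (3 / (w * ε ^ 2))) * ahL1 u := by gcongr
    _ = 6 * Cτ / ε ^ 2 * w⁻¹ * ahL1 u := by
        field_simp
        ring

/-! ### The Möbius reparametrisation `ρ_x` with `Φ(x, ρ_x(b')) = Φ(y, b')` -/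

/-- `γ = E_x A_y - A_x E_y` (`= 𝒪(w²)`). [folklore] -/
def ahMobC (w x y : ℝ) : ℝ := ahDenSlope w x * ahNumSlope w y - ahNumSlope w x * ahDenSlope w y

/-- **`ρ_x(b') = q A_y b' / (q A_x + γ b')`**, the unique solution `b = ρ_x(b')` of
`Φ(x, b) = Φ(y, b')` (`tan πΦ(x,·)` is the Möbius map `b ↦ A_x b/(q - E_x b)`). [folklore] -/
def ahMob (w x y b : ℝ) : ℝ :=
  ahSqrtQ w * ahNumSlope w y * b / (ahSqrtQ w * ahNumSlope w x + ahMobC w x y * b)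

/-- `ρ_x'(b') = q² A_x A_y / (q A_x + γ b')²`. [folklore] -/
def ahMobD (w x y b : ℝ) : ℝ :=
  ahSqrtQ w ^ 2 * ahNumSlope w x * ahNumSlope w y / (ahSqrtQ w * ahNumSlope w x + ahMobC w x y * b) ^ 2

/-- Derivative of a Möbius map `b ↦ P b / (Q + γ b)`. [folklore] -/
theorem hasDerivAt_mobius (P Q γ b : ℝ) (hden : Q + γ * b ≠ 0) :
    HasDerivAt (fun b => P * b / (Q + γ * b)) (P * Q / (Q + γ * b) ^ 2) b := by
  have h1 : HasDerivAt (fun b => P * b) P b := by simpa using (hasDerivAt_id b).const_mul P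
  have h2 : HasDerivAt (fun b => Q + γ * b) γ b := by
    simpa using ((hasDerivAt_id b).const_mul γ).const_add Q
  have h3 := h1.div h2 hden
  have h4 : HasDerivAt (fun b => P * b / (Q + γ * b)) ((P * (Q + γ * b) - P * b * γ) / (Q + γ * b) ^ 2) b := by
    simpa only [Pi.div_def] using h3
  refine h4.congr_deriv ?_
  congr 1; ring

/-- `HasDerivAt ρ_x ρ_x'`. [folklore] -/
theorem hasDerivAt_ahMob (w x y b : ℝ) (hden : ahSqrtQ w * ahNumSlope w x + ahMobC w x y * b ≠ 0) :
    HasDerivAt (fun b => ahMob w x y b) (ahMobD w x y b) b := by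
  have := hasDerivAt_mobius (ahSqrtQ w * ahNumSlope w y) (ahSqrtQ w * ahNumSlope w x) (ahMobC w x y) b hden
  unfold ahMob ahMobD
  refine this.congr_deriv ?_
  congr 1; ring

/-- `ρ_x` is measurable. [folklore] -/
theorem measurable_ahMob (w x y : ℝ) : Measurable fun b => ahMob w x y b := by
  unfold ahMob
  exact (measurable_const.mul measurable_id).div (measurable_const.add (measurable_const.mul measurable_id))

/-- `ρ_x` is injective wherever its denominator does not vanish (`P Q ≠ 0`). [folklore] -/
theorem ahMob_injOn {w x y : ℝ} {J : Set ℝ} (hq : ahSqrtQ w ≠ 0) (hAx : ahNumSlope w x ≠ 0)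
    (hAy : ahNumSlope w y ≠ 0) (hden : ∀ b ∈ J, ahSqrtQ w * ahNumSlope w x + ahMobC w x y * b ≠ 0) :
    InjOn (fun b => ahMob w x y b) J := by
  intro b₁ h₁ b₂ h₂ h
  have h' : ahSqrtQ w * ahNumSlope w y * b₁ / (ahSqrtQ w * ahNumSlope w x + ahMobC w x y * b₁) =
      ahSqrtQ w * ahNumSlope w y * b₂ / (ahSqrtQ w * ahNumSlope w x + ahMobC w x y * b₂) := h
  rw [div_eq_div_iff (hden b₁ h₁) (hden b₂ h₂)] at h'
  have h3 : ahSqrtQ w ^ 2 * ahNumSlope w x * ahNumSlope w y * (b₁ - b₂) = 0 := by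
    linear_combination h'
  rcases mul_eq_zero.mp h3 with h4 | h4
  · exact absurd h4 (mul_ne_zero (mul_ne_zero (pow_ne_zero 2 hq) hAx) hAy)
  · linarith

/-- `N_x(ρ_x(b')) = qA_x N_y(b')/den` and `D_x(ρ_x(b')) = qA_x D_y(b')/den`. [folklore] -/
theorem ahNum_ahDen_ahMob {w x y b : ℝ} (hden : ahSqrtQ w * ahNumSlope w x + ahMobC w x y * b ≠ 0) :
    ahNum w x (ahMob w x y b) =
        ahSqrtQ w * ahNumSlope w x * ahNum w y b / (ahSqrtQ w * ahNumSlope w x + ahMobC w x y * b) ∧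
      ahDen w x (ahMob w x y b) =
        ahSqrtQ w * ahNumSlope w x * ahDen w y b / (ahSqrtQ w * ahNumSlope w x + ahMobC w x y * b) := by
  rw [ahNum_eq_slope_mul, ahNum_eq_slope_mul w y, ahDen_eq_sub_slope_mul, ahDen_eq_sub_slope_mul w y]
  unfold ahMob
  set den := ahSqrtQ w * ahNumSlope w x + ahMobC w x y * b with hden_def
  constructor
  · rw [← mul_div_assoc]
    congr 1
    ring
  · rw [← mul_div_assoc, eq_div_iff hden, sub_mul, div_mul_cancel₀ _ hden, hden_def]
    unfold ahMobC
    ring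

/-- **The key identity `Φ(x, ρ_x(b')) = Φ(y, b')`.** [folklore] -/
theorem ahPhi_ahMob {w x y b : ℝ} (hq : ahSqrtQ w ≠ 0) (hAx : ahNumSlope w x ≠ 0)
    (hden : ahSqrtQ w * ahNumSlope w x + ahMobC w x y * b ≠ 0) :
    ahPhi w x (ahMob w x y b) = ahPhi w y b := by
  obtain ⟨hN, hD⟩ := ahNum_ahDen_ahMob hden
  unfold ahPhi
  congr 2
  rw [hN, hD]
  have hc : ahSqrtQ w * ahNumSlope w x ≠ 0 := mul_ne_zero hq hAx
  by_cases hDy : ahDen w y b = 0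
  · rw [hDy]; simp
  · field_simp

/-- `f_{ρ_x(b')}(x) = g_{b'}(x, y)`. [folklore] -/
theorem ahStep_ahMob {w x y b : ℝ} (hq : ahSqrtQ w ≠ 0) (hAx : ahNumSlope w x ≠ 0)
    (hden : ahSqrtQ w * ahNumSlope w x + ahMobC w x y * b ≠ 0) :
    ahStep w (ahMob w x y b) x = ahG w b x y := by
  unfold ahStep ahG
  rw [ahPhi_ahMob hq hAx hden]

/-- Near-identity Möbius maps, abstract version: if `m ≤ Q`, `|P - Q| ≤ δ`, `|γ| ≤ g`, `|b| ≤ B` and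
`3gB ≤ m`, then `Q + γb ≥ 2m/3`, `|Pb/(Q+γb) - b| ≤ 3B(δ + gB)/(2m)` and
`|PQ/(Q+γb)² - 1| ≤ 9(|Q|δ + 2|Q|gB + g²B²)/(4m²)`. [folklore] -/
theorem mobius_near_id {P Q γ b m δ g B : ℝ} (hm : 0 < m) (hQ : m ≤ Q) (hPQ : |P - Q| ≤ δ)
    (hγ : |γ| ≤ g) (hb : |b| ≤ B) (hgB : 3 * g * B ≤ m) :
    2 * m / 3 ≤ Q + γ * b ∧
      |P * b / (Q + γ * b) - b| ≤ 3 * B * (δ + g * B) / (2 * m) ∧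
      |P * Q / (Q + γ * b) ^ 2 - 1| ≤ 9 * (|Q| * δ + 2 * |Q| * g * B + g ^ 2 * B ^ 2) / (4 * m ^ 2) := by
  have hg0 : 0 ≤ g := (abs_nonneg γ).trans hγ
  have hB0 : 0 ≤ B := (abs_nonneg b).trans hb
  have hδ0 : 0 ≤ δ := (abs_nonneg _).trans hPQ
  have hγb : |γ * b| ≤ g * B := by rw [abs_mul]; exact mul_le_mul hγ hb (abs_nonneg _) hg0
  have hden : 2 * m / 3 ≤ Q + γ * b := by
    have := neg_abs_le (γ * b)
    nlinarith
  have hden0 : 0 < Q + γ * b := by linarith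
  have hne : Q + γ * b ≠ 0 := hden0.ne'
  refine ⟨hden, ?_, ?_⟩
  · have h1 : P * b / (Q + γ * b) - b = b * (P - Q - γ * b) / (Q + γ * b) := by
      rw [eq_div_iff hne, sub_mul, div_mul_cancel₀ _ hne]; ring
    rw [h1, abs_div, abs_of_pos hden0, abs_mul, div_le_div_iff₀ hden0 (by positivity)]
    have h2 : |P - Q - γ * b| ≤ δ + g * B := by
      calc |P - Q - γ * b| ≤ |P - Q| + |γ * b| := abs_sub _ _
        _ ≤ δ + g * B := add_le_add hPQ hγb
    have h3 : |b| * |P - Q - γ * b| ≤ B * (δ + g * B) :=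
      mul_le_mul hb h2 (abs_nonneg _) hB0
    calc |b| * |P - Q - γ * b| * (2 * m) ≤ B * (δ + g * B) * (2 * m) := by gcongr
      _ = 3 * B * (δ + g * B) * (2 * m / 3) := by ring
      _ ≤ 3 * B * (δ + g * B) * (Q + γ * b) := by gcongr
  · have hden2 : 0 < (Q + γ * b) ^ 2 := by positivity
    have hne2 : (Q + γ * b) ^ 2 ≠ 0 := pow_ne_zero 2 hne
    have h1 : P * Q / (Q + γ * b) ^ 2 - 1 =
        (Q * (P - Q) - 2 * Q * (γ * b) - (γ * b) ^ 2) / (Q + γ * b) ^ 2 := by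
      rw [eq_div_iff hne2, sub_mul, div_mul_cancel₀ _ hne2]; ring
    rw [h1, abs_div, abs_of_pos hden2, div_le_div_iff₀ hden2 (by positivity)]
    have h2 : |Q * (P - Q) - 2 * Q * (γ * b) - (γ * b) ^ 2| ≤
        |Q| * δ + 2 * |Q| * g * B + g ^ 2 * B ^ 2 := by
      calc |Q * (P - Q) - 2 * Q * (γ * b) - (γ * b) ^ 2|
          ≤ |Q * (P - Q) - 2 * Q * (γ * b)| + |(γ * b) ^ 2| := abs_sub _ _
        _ ≤ |Q * (P - Q)| + |2 * Q * (γ * b)| + |(γ * b) ^ 2| := by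
            gcongr; exact abs_sub _ _
        _ = |Q| * |P - Q| + 2 * |Q| * |γ * b| + |γ * b| ^ 2 := by
            rw [abs_mul, abs_mul, abs_mul, abs_pow, abs_two]
        _ ≤ |Q| * δ + 2 * |Q| * (g * B) + (g * B) ^ 2 := by
            gcongr
        _ = |Q| * δ + 2 * |Q| * g * B + g ^ 2 * B ^ 2 := by ring
    have h4 : (2 * m / 3) ^ 2 ≤ (Q + γ * b) ^ 2 := pow_le_pow_left₀ (by positivity) hden 2
    calc |Q * (P - Q) - 2 * Q * (γ * b) - (γ * b) ^ 2| * (4 * m ^ 2)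
        ≤ (|Q| * δ + 2 * |Q| * g * B + g ^ 2 * B ^ 2) * (4 * m ^ 2) := by gcongr
      _ = 9 * (|Q| * δ + 2 * |Q| * g * B + g ^ 2 * B ^ 2) * (2 * m / 3) ^ 2 := by ring
      _ ≤ 9 * (|Q| * δ + 2 * |Q| * g * B + g ^ 2 * B ^ 2) * (Q + γ * b) ^ 2 := by gcongr

/-- **`ρ_x` is `𝒪(w)`-close to the identity**: for `|sin πx|, |sin πy| ≥ ε`, `|x - y| ≤ c₃w`,
`|b'| ≤ B'` and `w ≤ w₂(ε, B')`, the denominator of `ρ_x` is `≥ πwε²/2`,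
`|ρ_x(b') - b'| ≤ c_ρ w`, `|ρ_x'(b') - 1| ≤ c_ρ' w` and `ρ_x' > 0`. [folklore] -/
theorem ahMob_bounds {ε c₃ B' : ℝ} (hε : 0 < ε) (hc₃ : 0 ≤ c₃) (hB' : 0 < B') :
    ∃ w₂ : ℝ, 0 < w₂ ∧ ∃ cρ : ℝ, 0 ≤ cρ ∧ ∃ cρ' : ℝ, 0 ≤ cρ' ∧
      ∀ w ∈ Ioc 0 w₂, ∀ x y : ℝ, ε ≤ |Real.sin (π * x)| → ε ≤ |Real.sin (π * y)| →
        |x - y| ≤ c₃ * w → ∀ b : ℝ, |b| ≤ B' →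
          π * w * ε ^ 2 / 2 ≤ ahSqrtQ w * ahNumSlope w x + ahMobC w x y * b ∧
          |ahMob w x y b - b| ≤ cρ * w ∧ |ahMobD w x y b - 1| ≤ cρ' * w ∧ 0 < ahMobD w x y b := by
  refine ⟨min (1 / (2 * π)) (ε ^ 2 / (4 * π * B')), by positivity,
    2 * π * B' * (2 * c₃ + B') / ε ^ 2, by positivity,
    4 * π * (2 * c₃ + 2 * B' + B' ^ 2) / ε ^ 4, by positivity, ?_⟩
  intro w hw x y hSx hSy hxy b hb
  obtain ⟨hw0, hwle⟩ := hw
  have hw1 : w ≤ 1 / (2 * π) := hwle.trans (min_le_left _ _)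
  have hw2 : w ≤ ε ^ 2 / (4 * π * B') := hwle.trans (min_le_right _ _)
  have hπ := Real.pi_pos
  have hπw : π * w ≤ 1 / 2 := by
    rw [le_div_iff₀ (by positivity)] at hw1; linarith
  have hwB : 4 * π * w * B' ≤ ε ^ 2 := by
    rw [le_div_iff₀ (by positivity)] at hw2; linarith
  obtain ⟨hq_lo, hq_hi, -, -, -⟩ := ahQDN_bounds hw0.le (b := 0) (by rw [abs_zero]; linarith) x
  have hSx2 : ε ^ 2 ≤ Real.sin (π * x) ^ 2 := by
    rw [← sq_abs (Real.sin _)]; exact pow_le_pow_left₀ hε.le hSx 2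
  have hSy2 : ε ^ 2 ≤ Real.sin (π * y) ^ 2 := by
    rw [← sq_abs (Real.sin _)]; exact pow_le_pow_left₀ hε.le hSy 2
  have hAx_lo : π * w * ε ^ 2 ≤ ahNumSlope w x := mul_le_mul_of_nonneg_left hSx2 (by positivity)
  have hAy_lo : π * w * ε ^ 2 ≤ ahNumSlope w y := mul_le_mul_of_nonneg_left hSy2 (by positivity)
  have hAx_hi : ahNumSlope w x ≤ π * w := ahNumSlope_le hw0.le x
  have hAx0 : 0 < ahNumSlope w x := lt_of_lt_of_le (by positivity) hAx_lo
  have hAy0 : 0 < ahNumSlope w y := lt_of_lt_of_le (by positivity) hAy_lo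
  have hAdiff : |ahNumSlope w y - ahNumSlope w x| ≤ 2 * π ^ 2 * c₃ * w ^ 2 := by
    unfold ahNumSlope
    rw [← mul_sub, abs_mul, abs_of_pos (by positivity : 0 < π * w), sq_sub_sq, abs_mul]
    have h1 : |Real.sin (π * y) + Real.sin (π * x)| ≤ 2 := by
      calc _ ≤ |Real.sin (π * y)| + |Real.sin (π * x)| := abs_add_le _ _
        _ ≤ 1 + 1 := add_le_add (Real.abs_sin_le_one _) (Real.abs_sin_le_one _)
        _ = 2 := by norm_num
    have h2 : |Real.sin (π * y) - Real.sin (π * x)| ≤ π * (c₃ * w) := by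
      calc _ ≤ |π * y - π * x| := Real.abs_sin_sub_sin_le _ _
        _ = π * |x - y| := by rw [← mul_sub, abs_mul, abs_of_pos hπ, abs_sub_comm]
        _ ≤ π * (c₃ * w) := mul_le_mul_of_nonneg_left hxy hπ.le
    calc π * w * (|Real.sin (π * y) + Real.sin (π * x)| * |Real.sin (π * y) - Real.sin (π * x)|)
        ≤ π * w * (2 * (π * (c₃ * w))) :=
          mul_le_mul_of_nonneg_left (mul_le_mul h1 h2 (abs_nonneg _) zero_le_two) (by positivity)
      _ = 2 * π ^ 2 * c₃ * w ^ 2 := by ring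
  have hγ : |ahMobC w x y| ≤ π ^ 2 * w ^ 2 := by
    unfold ahMobC
    have e1 := abs_ahDenSlope_le hw0.le x
    have e2 := abs_ahDenSlope_le hw0.le y
    have a1 : |ahNumSlope w y| ≤ π * w := by rw [abs_of_pos hAy0]; exact ahNumSlope_le hw0.le y
    have a2 : |ahNumSlope w x| ≤ π * w := by rw [abs_of_pos hAx0]; exact hAx_hi
    calc _ ≤ |ahDenSlope w x * ahNumSlope w y| + |ahNumSlope w x * ahDenSlope w y| := abs_sub _ _
      _ = |ahDenSlope w x| * |ahNumSlope w y| + |ahNumSlope w x| * |ahDenSlope w y| := by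
          rw [abs_mul, abs_mul]
      _ ≤ π * w / 2 * (π * w) + π * w * (π * w / 2) :=
          add_le_add (mul_le_mul e1 a1 (abs_nonneg _) (by positivity))
            (mul_le_mul a2 e2 (abs_nonneg _) (by positivity))
      _ = π ^ 2 * w ^ 2 := by ring
  -- the abstract Möbius lemma
  set q := ahSqrtQ w with hq_def
  have hq0 : 0 < q := by linarith
  have hm : 0 < 3 / 4 * (π * w * ε ^ 2) := by positivity
  have hQ : 3 / 4 * (π * w * ε ^ 2) ≤ q * ahNumSlope w x := by
    calc 3 / 4 * (π * w * ε ^ 2) ≤ q * (π * w * ε ^ 2) := by gcongr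
      _ ≤ q * ahNumSlope w x := mul_le_mul_of_nonneg_left hAx_lo hq0.le
  have hPQ : |q * ahNumSlope w y - q * ahNumSlope w x| ≤ 2 * π ^ 2 * c₃ * w ^ 2 := by
    rw [← mul_sub, abs_mul, abs_of_pos hq0]
    calc q * |ahNumSlope w y - ahNumSlope w x| ≤ 1 * |ahNumSlope w y - ahNumSlope w x| := by gcongr
      _ ≤ _ := by rw [one_mul]; exact hAdiff
  have hgB : 3 * (π ^ 2 * w ^ 2) * B' ≤ 3 / 4 * (π * w * ε ^ 2) := by nlinarith
  obtain ⟨hden, hρ, hρ'⟩ := mobius_near_id hm hQ hPQ hγ hb hgB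
  have hden' : π * w * ε ^ 2 / 2 ≤ q * ahNumSlope w x + ahMobC w x y * b := by linarith
  have hden0 : 0 < q * ahNumSlope w x + ahMobC w x y * b := lt_of_lt_of_le (by positivity) hden'
  refine ⟨hden', ?_, ?_, ?_⟩
  · -- `|ρ - b| ≤ cρ w`
    refine hρ.trans (le_of_eq ?_)
    field_simp
    ring
  · -- `|ρ' - 1| ≤ cρ' w`
    have hD : ahMobD w x y b = q * ahNumSlope w y * (q * ahNumSlope w x) /
        (q * ahNumSlope w x + ahMobC w x y * b) ^ 2 := by
      unfold ahMobD; rw [← hq_def]; ring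
    rw [hD]
    refine hρ'.trans ?_
    have hQabs : |q * ahNumSlope w x| ≤ π * w := by
      rw [abs_of_pos (mul_pos hq0 hAx0)]
      calc q * ahNumSlope w x ≤ 1 * (π * w) := mul_le_mul hq_hi hAx_hi hAx0.le zero_le_one
        _ = π * w := one_mul _
    calc 9 * (|q * ahNumSlope w x| * (2 * π ^ 2 * c₃ * w ^ 2) +
          2 * |q * ahNumSlope w x| * (π ^ 2 * w ^ 2) * B' + (π ^ 2 * w ^ 2) ^ 2 * B' ^ 2) /
          (4 * (3 / 4 * (π * w * ε ^ 2)) ^ 2)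
        ≤ 9 * ((π * w) * (2 * π ^ 2 * c₃ * w ^ 2) +
          2 * (π * w) * (π ^ 2 * w ^ 2) * B' + (π ^ 2 * w ^ 2) ^ 2 * B' ^ 2) /
          (4 * (3 / 4 * (π * w * ε ^ 2)) ^ 2) := by gcongr
      _ = 4 * π * (2 * c₃ + 2 * B' + π * w * B' ^ 2) / ε ^ 4 * w := by
          field_simp
          ring
      _ ≤ 4 * π * (2 * c₃ + 2 * B' + 1 * B' ^ 2) / ε ^ 4 * w := by gcongr; linarith
      _ = 4 * π * (2 * c₃ + 2 * B' + B' ^ 2) / ε ^ 4 * w := by rw [one_mul]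
  · -- `ρ' > 0`
    unfold ahMobD
    rw [← hq_def]
    positivity

/-- **`Tu(x)` in the variable `b'`**: `Tu(x) = ∫_{J'} ρ_x'(b') u(g_{b'}(x,y)) (1 + w h(x) ρ_x(b'))
τ(ρ_x(b')) db'`, `J' = [b₋ - 1, b₊ + 1]`, by the change of variables `b = ρ_x(b')` and the identity
`f_{ρ_x(b')}(x) = g_{b'}(x, y)`. [cite: AjankiHuveneers2011, proof of Lemma 5.4] -/
theorem ahT_eq_integral_ahMob {τ : ℝ → ℝ} {bm bp : ℝ} (hτ : ReducedLawHyp τ bm bp) {w x y : ℝ}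
    (h u : ℝ → ℝ) (hq : ahSqrtQ w ≠ 0) (hAx : ahNumSlope w x ≠ 0) (hAy : ahNumSlope w y ≠ 0)
    (hden : ∀ b ∈ Icc (bm - 1) (bp + 1), ahSqrtQ w * ahNumSlope w x + ahMobC w x y * b ≠ 0)
    (hlo : ahMob w x y (bm - 1) ≤ bm) (hhi : bp ≤ ahMob w x y (bp + 1))
    (hpos : ∀ b ∈ Icc (bm - 1) (bp + 1), 0 ≤ ahMobD w x y b) :
    ahT τ w h u x = ∫ b in Icc (bm - 1) (bp + 1), ahMobD w x y b *
      (u (ahG w b x y) * ((1 + w * h x * ahMob w x y b) * τ (ahMob w x y b))) := by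
  have hcont : ContinuousOn (fun b => ahMob w x y b) (Icc (bm - 1) (bp + 1)) := fun b hb =>
    (hasDerivAt_ahMob w x y b (hden b hb)).continuousAt.continuousWithinAt
  have hsub : Icc bm bp ⊆ (fun b => ahMob w x y b) '' Icc (bm - 1) (bp + 1) := by
    have hJ : bm - 1 ≤ bp + 1 := by linarith [hτ.lt]
    exact Subset.trans (Icc_subset_Icc hlo hhi) (intermediate_value_Icc hJ hcont)
  have h1 : ahT τ w h u x = ∫ b in (fun b => ahMob w x y b) '' Icc (bm - 1) (bp + 1),
      u (ahStep w b x) * ((1 + w * h x * b) * τ b) := by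
    unfold ahT
    rw [setIntegral_eq_integral_of_forall_compl_eq_zero]
    intro b hb
    have hb' : b ∉ Icc bm bp := fun h' => hb (hsub h')
    rw [hτ.eq_zero b hb', mul_zero, mul_zero]
  have h2 := integral_image_eq_integral_abs_deriv_smul measurableSet_Icc
    (fun b hb => (hasDerivAt_ahMob w x y b (hden b hb)).hasDerivWithinAt)
    (ahMob_injOn hq hAx hAy hden) (fun b => u (ahStep w b x) * ((1 + w * h x * b) * τ b))
  rw [h1, h2]
  refine setIntegral_congr_fun measurableSet_Icc fun b hb => ?_
  simp only [smul_eq_mul]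
  rw [abs_of_nonneg (hpos b hb), ahStep_ahMob hq hAx (hden b hb)]

/-- `T_y u(x) = ∫_{J'} u(g_{b'}(x,y)) (1 + w h(y) b') τ(b') db'` (`τ` vanishes off `[b₋,b₊] ⊂ J'`).
[cite: AjankiHuveneers2011, §5 eq. (5.6)] -/
theorem ahTy_eq_setIntegral {τ : ℝ → ℝ} {bm bp : ℝ} (hτ : ReducedLawHyp τ bm bp) (w : ℝ)
    (h u : ℝ → ℝ) (x y : ℝ) :
    ahTy τ w h y u x = ∫ b in Icc (bm - 1) (bp + 1), u (ahG w b x y) * ((1 + w * h y * b) * τ b) := by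
  unfold ahTy
  rw [setIntegral_eq_integral_of_forall_compl_eq_zero]
  intro b hb
  have hb' : b ∉ Icc bm bp := fun h' => hb (Icc_subset_Icc (by linarith) (by linarith) h')
  rw [hτ.eq_zero b hb', mul_zero, mul_zero]

/-! ### Eq. (5.14): the kernel difference `Δ_x` and its bound -/

/-- Abstract three-term bound for `Δ = ρ'(1 + w hₓ ρ)τ(ρ) - (1 + w h_y b)τ(b)`:
`|Δ| ≤ |ρ' - 1|·2‖τ‖ + w|hₓρ - h_y b|·‖τ‖ + 2|τ(ρ) - τ(b)|`. [folklore] -/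
theorem delta_bound {ρ ρ' b τρ τb hx hy w c₁ c₂ c₄ H B' Cτ T : ℝ}
    (hρ' : |ρ' - 1| ≤ c₁ * w) (hρ : |ρ - b| ≤ c₂ * w) (hh : |hx - hy| ≤ c₄ * w) (hHx : |hx| ≤ H)
    (hHy : |hy| ≤ H) (hb : |b| ≤ B') (hτρ0 : 0 ≤ τρ) (hτρ : τρ ≤ Cτ)
    (hT : |τρ - τb| ≤ T) (hw0 : 0 ≤ w) (hw1 : w ≤ 1)
    (hwH : w * H * (B' + 1) ≤ 1) (hc₂w : c₂ * w ≤ 1) :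
    |ρ' * ((1 + w * hx * ρ) * τρ) - (1 + w * hy * b) * τb| ≤
      (2 * Cτ * c₁ + H * c₂ * Cτ + c₄ * B' * Cτ) * w + 2 * T := by
  have hH0 : 0 ≤ H := (abs_nonneg _).trans hHx
  have hB0 : 0 ≤ B' := (abs_nonneg _).trans hb
  have hCτ0 : 0 ≤ Cτ := hτρ0.trans hτρ
  have hc₁0 : 0 ≤ c₁ * w := (abs_nonneg _).trans hρ'
  have hc₂0 : 0 ≤ c₂ * w := (abs_nonneg _).trans hρ
  have hc₄0 : 0 ≤ c₄ * w := (abs_nonneg _).trans hh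
  have hρB : |ρ| ≤ B' + 1 := by
    calc |ρ| = |(ρ - b) + b| := by ring_nf
      _ ≤ |ρ - b| + |b| := abs_add_le _ _
      _ ≤ c₂ * w + B' := add_le_add hρ hb
      _ ≤ B' + 1 := by linarith
  have hm1 : |w * hx * ρ| ≤ 1 := by
    rw [abs_mul, abs_mul, abs_of_nonneg hw0]
    calc w * |hx| * |ρ| ≤ w * H * (B' + 1) := by gcongr
      _ ≤ 1 := hwH
  have hm2 : |w * hy * b| ≤ 1 := by
    rw [abs_mul, abs_mul, abs_of_nonneg hw0]
    calc w * |hy| * |b| ≤ w * H * (B' + 1) := by gcongr; linarith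
      _ ≤ 1 := hwH
  have hmρ : |1 + w * hx * ρ| ≤ 2 := by
    calc |1 + w * hx * ρ| ≤ |(1 : ℝ)| + |w * hx * ρ| := abs_add_le _ _
      _ ≤ 1 + 1 := by rw [abs_one]; exact add_le_add le_rfl hm1
      _ = 2 := by norm_num
  have hmb : |1 + w * hy * b| ≤ 2 := by
    calc |1 + w * hy * b| ≤ |(1 : ℝ)| + |w * hy * b| := abs_add_le _ _
      _ ≤ 1 + 1 := by rw [abs_one]; exact add_le_add le_rfl hm2
      _ = 2 := by norm_num
  have hdm : |w * hx * ρ - w * hy * b| ≤ (H * c₂ + c₄ * B') * w := by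
    have e : w * hx * ρ - w * hy * b = w * (hx * (ρ - b) + (hx - hy) * b) := by ring
    rw [e, abs_mul, abs_of_nonneg hw0]
    have h1 : |hx * (ρ - b) + (hx - hy) * b| ≤ H * (c₂ * w) + c₄ * w * B' := by
      calc _ ≤ |hx * (ρ - b)| + |(hx - hy) * b| := abs_add_le _ _
        _ = |hx| * |ρ - b| + |hx - hy| * |b| := by rw [abs_mul, abs_mul]
        _ ≤ H * (c₂ * w) + c₄ * w * B' := by gcongr
    have h0 : 0 ≤ (H * c₂ + c₄ * B') * w := by
      nlinarith [mul_nonneg hH0 hc₂0, mul_nonneg hB0 hc₄0]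
    calc w * |hx * (ρ - b) + (hx - hy) * b| ≤ w * (H * (c₂ * w) + c₄ * w * B') := by gcongr
      _ = (H * c₂ + c₄ * B') * w * w := by ring
      _ ≤ (H * c₂ + c₄ * B') * w * 1 := mul_le_mul_of_nonneg_left hw1 h0
      _ = (H * c₂ + c₄ * B') * w := by ring
  have h0 : 0 ≤ (H * c₂ + c₄ * B') * w := by
    nlinarith [mul_nonneg hH0 hc₂0, mul_nonneg hB0 hc₄0]
  have e : ρ' * ((1 + w * hx * ρ) * τρ) - (1 + w * hy * b) * τb =
      (ρ' - 1) * ((1 + w * hx * ρ) * τρ) + (w * hx * ρ - w * hy * b) * τρ +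
        (1 + w * hy * b) * (τρ - τb) := by ring
  rw [e]
  have hτρa : |τρ| ≤ Cτ := by rw [abs_of_nonneg hτρ0]; exact hτρ
  calc _ ≤ |(ρ' - 1) * ((1 + w * hx * ρ) * τρ) + (w * hx * ρ - w * hy * b) * τρ| +
        |(1 + w * hy * b) * (τρ - τb)| := abs_add_le _ _
    _ ≤ |(ρ' - 1) * ((1 + w * hx * ρ) * τρ)| + |(w * hx * ρ - w * hy * b) * τρ| +
        |(1 + w * hy * b) * (τρ - τb)| := by gcongr; exact abs_add_le _ _
    _ = |ρ' - 1| * (|1 + w * hx * ρ| * |τρ|) + |w * hx * ρ - w * hy * b| * |τρ| +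
        |1 + w * hy * b| * |τρ - τb| := by rw [abs_mul, abs_mul, abs_mul, abs_mul]
    _ ≤ c₁ * w * (2 * Cτ) + (H * c₂ + c₄ * B') * w * Cτ + 2 * T := by
        have t1 : |ρ' - 1| * (|1 + w * hx * ρ| * |τρ|) ≤ c₁ * w * (2 * Cτ) :=
          mul_le_mul hρ' (mul_le_mul hmρ hτρa (abs_nonneg _) zero_le_two) (by positivity) hc₁0
        have t2 : |w * hx * ρ - w * hy * b| * |τρ| ≤ (H * c₂ + c₄ * B') * w * Cτ :=
          mul_le_mul hdm hτρa (abs_nonneg _) h0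
        have t3 : |1 + w * hy * b| * |τρ - τb| ≤ 2 * T :=
          mul_le_mul hmb hT (abs_nonneg _) zero_le_two
        linarith
    _ = (2 * Cτ * c₁ + H * c₂ * Cτ + c₄ * B' * Cτ) * w + 2 * T := by ring

/-- The jump-aware Lipschitz bound for `τ`: if `|ρ - b| ≤ r` then
`|τ(ρ) - τ(b)| ≤ L r + 2‖τ‖_∞ (𝟙_{[b₋-r, b₋+r]}(b) + 𝟙_{[b₊-r, b₊+r]}(b))` (outside the two windows,
`ρ` and `b` lie on the same side of `b₋` and of `b₊`). [cite: AjankiHuveneers2011, proof of Lemma 5.4] -/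
theorem tau_diff_bound {τ : ℝ → ℝ} {bm bp : ℝ} (hτ : ReducedLawHyp τ bm bp) {L : ℝ}
    (hL : ∀ b₁ ∈ Icc bm bp, ∀ b₂ ∈ Icc bm bp, |τ b₁ - τ b₂| ≤ L * |b₁ - b₂|) (hL0 : 0 ≤ L)
    {Cτ : ℝ} (hCτ : ∀ s, |τ s| ≤ Cτ) {ρ b r : ℝ} (hr : 0 ≤ r) (hρ : |ρ - b| ≤ r) :
    |τ ρ - τ b| ≤ L * r + 2 * Cτ * ((Icc (bm - r) (bm + r)).indicator 1 b +
      (Icc (bp - r) (bp + r)).indicator 1 b) := by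
  have hCτ0 : 0 ≤ Cτ := (abs_nonneg _).trans (hCτ 0)
  have hind1 : 0 ≤ (Icc (bm - r) (bm + r)).indicator (1 : ℝ → ℝ) b :=
    Set.indicator_nonneg (fun _ _ => zero_le_one) b
  have hind2 : 0 ≤ (Icc (bp - r) (bp + r)).indicator (1 : ℝ → ℝ) b :=
    Set.indicator_nonneg (fun _ _ => zero_le_one) b
  have hcrude : |τ ρ - τ b| ≤ 2 * Cτ := by
    calc |τ ρ - τ b| ≤ |τ ρ| + |τ b| := abs_sub _ _
      _ ≤ Cτ + Cτ := add_le_add (hCτ ρ) (hCτ b)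
      _ = 2 * Cτ := by ring
  obtain ⟨hρ1, hρ2⟩ := abs_le.mp hρ
  by_cases h1 : b ∈ Icc (bm - r) (bm + r)
  · rw [Set.indicator_of_mem h1, Pi.one_apply]
    nlinarith
  by_cases h2 : b ∈ Icc (bp - r) (bp + r)
  · rw [Set.indicator_of_mem h2, Pi.one_apply]
    nlinarith
  rw [Set.indicator_of_notMem h1, Set.indicator_of_notMem h2, add_zero, mul_zero, add_zero]
  rw [mem_Icc, not_and_or, not_le, not_le] at h1 h2
  rcases h1 with h1 | h1
  · -- `b < b₋ - r`: both `ρ` and `b` are below `b₋`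
    have hb' : b ∉ Icc bm bp := fun h => by linarith [h.1]
    have hρ' : ρ ∉ Icc bm bp := fun h => by linarith [h.1]
    rw [hτ.eq_zero b hb', hτ.eq_zero ρ hρ', sub_zero, abs_zero]
    positivity
  rcases h2 with h2 | h2
  · -- `b₋ + r < b < b₊ - r`: both in `[b₋, b₊]`
    have hbI : b ∈ Icc bm bp := ⟨by linarith, by linarith⟩
    have hρI : ρ ∈ Icc bm bp := ⟨by linarith, by linarith⟩
    calc |τ ρ - τ b| ≤ L * |ρ - b| := hL ρ hρI b hbI
      _ ≤ L * r := mul_le_mul_of_nonneg_left hρ hL0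
  · -- `b > b₊ + r`: both above `b₊`
    have hb' : b ∉ Icc bm bp := fun h => by linarith [h.2]
    have hρ' : ρ ∉ Icc bm bp := fun h => by linarith [h.2]
    rw [hτ.eq_zero b hb', hτ.eq_zero ρ hρ', sub_zero, abs_zero]
    positivity

/-- The majorant `β(b') = C_Δ w + 4‖τ‖_∞ (𝟙_{W₋}(b') + 𝟙_{W₊}(b'))` of `|Δ_x(b')|`, uniform in `x`.
[cite: AjankiHuveneers2011, proof of Lemma 5.4] -/
def ahBeta (bm bp CΔ Cτ r w b : ℝ) : ℝ :=
  CΔ * w + 4 * Cτ * ((Icc (bm - r) (bm + r)).indicator 1 b + (Icc (bp - r) (bp + r)).indicator 1 b)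

/-- `β` is measurable. [folklore] -/
theorem measurable_ahBeta (bm bp CΔ Cτ r w : ℝ) : Measurable fun b => ahBeta bm bp CΔ Cτ r w b := by
  unfold ahBeta
  exact measurable_const.add (measurable_const.mul
    ((measurable_one.indicator measurableSet_Icc).add (measurable_one.indicator measurableSet_Icc)))

/-- `β ≥ 0`. [folklore] -/
theorem ahBeta_nonneg {bm bp CΔ Cτ r w : ℝ} (hC : 0 ≤ CΔ * w) (hCτ : 0 ≤ Cτ) (b : ℝ) :
    0 ≤ ahBeta bm bp CΔ Cτ r w b := by
  unfold ahBeta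
  have h1 : 0 ≤ (Icc (bm - r) (bm + r)).indicator (1 : ℝ → ℝ) b :=
    Set.indicator_nonneg (fun _ _ => zero_le_one) b
  have h2 : 0 ≤ (Icc (bp - r) (bp + r)).indicator (1 : ℝ → ℝ) b :=
    Set.indicator_nonneg (fun _ _ => zero_le_one) b
  positivity

/-- `β ≤ C_Δ w + 8‖τ‖_∞`. [folklore] -/
theorem ahBeta_le (bm bp CΔ r w : ℝ) {Cτ : ℝ} (hCτ : 0 ≤ Cτ) (b : ℝ) :
    ahBeta bm bp CΔ Cτ r w b ≤ CΔ * w + 8 * Cτ := by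
  unfold ahBeta
  have h1 : (Icc (bm - r) (bm + r)).indicator (1 : ℝ → ℝ) b ≤ 1 :=
    Set.indicator_le_self' (fun _ _ => zero_le_one) b
  have h2 : (Icc (bp - r) (bp + r)).indicator (1 : ℝ → ℝ) b ≤ 1 :=
    Set.indicator_le_self' (fun _ _ => zero_le_one) b
  nlinarith

/-- `b' ↦ g_{b'}(x, y)` is measurable. [folklore] -/
theorem measurable_ahG_left (w x y : ℝ) : Measurable fun b => ahG w b x y := by
  unfold ahG
  exact measurable_const.add (measurable_ahPhi_right w y)

/-- `ρ_x'` is measurable. [folklore] -/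
theorem measurable_ahMobD (w x y : ℝ) : Measurable fun b => ahMobD w x y b := by
  unfold ahMobD
  exact measurable_const.div ((measurable_const.add (measurable_const.mul measurable_id)).pow_const 2)

/-- `|b'| ≤ max(|b₋|,|b₊|) + 1` on `J' = [b₋ - 1, b₊ + 1]`. [folklore] -/
theorem abs_le_of_mem_Icc_ext {bm bp b : ℝ} (hb : b ∈ Icc (bm - 1) (bp + 1)) :
    |b| ≤ max |bm| |bp| + 1 := by
  obtain ⟨h1, h2⟩ := hb
  rw [abs_le]
  constructor
  · have := neg_abs_le bm; have := le_max_left |bm| |bp|; linarith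
  · have := le_abs_self bp; have := le_max_right |bm| |bp|; linarith

/-- **Pointwise bound on `R_y u(x)` for `x` `𝒪(w)`-close to `y`**:
`|R_y u(x)| ≤ ∫_{J'} u(g_{b'}(x,y)) β(b') db'`. [cite: AjankiHuveneers2011, proof of Lemma 5.4] -/
theorem ahRy_pointwise_bound {τ : ℝ → ℝ} {bm bp : ℝ} (hτ : ReducedLawHyp τ bm bp) {h : ℝ → ℝ}
    {H Lh : ℝ} (hH : ∀ x, |h x| ≤ H) (hLh : ∀ x y, |h x - h y| ≤ Lh * |x - y|) (hLh0 : 0 ≤ Lh)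
    {Cτ : ℝ} (hCτ : ∀ s, |τ s| ≤ Cτ) (hCτ0 : 0 ≤ Cτ)
    {L : ℝ} (hL : ∀ b₁ ∈ Icc bm bp, ∀ b₂ ∈ Icc bm bp, |τ b₁ - τ b₂| ≤ L * |b₁ - b₂|) (hL0 : 0 ≤ L)
    {ε c₃ w cρ cρ' : ℝ} (hε : 0 < ε) (hc₃ : 0 ≤ c₃) (hcρ : 0 ≤ cρ) (hcρ' : 0 ≤ cρ')
    (hw0 : 0 < w) (hw1 : w ≤ 1) (hcρw : cρ * w ≤ 1)
    (hwH : w * H * (max |bm| |bp| + 1 + 1) ≤ 1) (hwq : π * w ≤ 1 / 2)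
    {x y : ℝ} (hSx : ε ≤ |Real.sin (π * x)|) (hSy : ε ≤ |Real.sin (π * y)|)
    (hxy : |x - y| ≤ c₃ * w)
    (hmob : ∀ b : ℝ, |b| ≤ max |bm| |bp| + 1 →
      π * w * ε ^ 2 / 2 ≤ ahSqrtQ w * ahNumSlope w x + ahMobC w x y * b ∧
      |ahMob w x y b - b| ≤ cρ * w ∧ |ahMobD w x y b - 1| ≤ cρ' * w ∧ 0 < ahMobD w x y b)
    {u : ℝ → ℝ} (hum : Measurable u) (hu0 : ∀ z, 0 ≤ u z) {M : ℝ} (hM : ∀ z, u z ≤ M) :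
    |ahRy τ w h y u x| ≤ ∫ b in Icc (bm - 1) (bp + 1), u (ahG w b x y) *
      ahBeta bm bp (2 * Cτ * cρ' + H * cρ * Cτ + Lh * c₃ * (max |bm| |bp| + 1) * Cτ + 2 * L * cρ)
        Cτ (cρ * w) w b := by
  set B' := max |bm| |bp| + 1 with hB'
  have hB'0 : 0 < B' := by
    have : 0 ≤ max |bm| |bp| := le_max_of_le_left (abs_nonneg _)
    rw [hB']; linarith
  have hH0 : 0 ≤ H := (abs_nonneg _).trans (hH 0)
  have hM0 : 0 ≤ M := (hu0 0).trans (hM 0)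
  have hbJ : ∀ b ∈ Icc (bm - 1) (bp + 1), |b| ≤ B' := fun b hb => abs_le_of_mem_Icc_ext hb
  have hmJ : bm - 1 ∈ Icc (bm - 1) (bp + 1) := ⟨le_rfl, by linarith [hτ.lt]⟩
  have hpJ : bp + 1 ∈ Icc (bm - 1) (bp + 1) := ⟨by linarith [hτ.lt], le_rfl⟩
  -- non-degeneracy
  obtain ⟨hq_lo, -, -, -, -⟩ := ahQDN_bounds hw0.le (b := 0) (by rw [abs_zero]; linarith) x
  have hq : ahSqrtQ w ≠ 0 := by linarith
  have hSx2 : ε ^ 2 ≤ Real.sin (π * x) ^ 2 := by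
    rw [← sq_abs (Real.sin _)]; exact pow_le_pow_left₀ hε.le hSx 2
  have hSy2 : ε ^ 2 ≤ Real.sin (π * y) ^ 2 := by
    rw [← sq_abs (Real.sin _)]; exact pow_le_pow_left₀ hε.le hSy 2
  have hAx : ahNumSlope w x ≠ 0 :=
    (lt_of_lt_of_le (by positivity) (mul_le_mul_of_nonneg_left hSx2 (by positivity) :
      π * w * ε ^ 2 ≤ ahNumSlope w x)).ne'
  have hAy : ahNumSlope w y ≠ 0 :=
    (lt_of_lt_of_le (by positivity) (mul_le_mul_of_nonneg_left hSy2 (by positivity) :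
      π * w * ε ^ 2 ≤ ahNumSlope w y)).ne'
  have hden : ∀ b ∈ Icc (bm - 1) (bp + 1),
      ahSqrtQ w * ahNumSlope w x + ahMobC w x y * b ≠ 0 := fun b hb =>
    (lt_of_lt_of_le (by positivity) (hmob b (hbJ b hb)).1).ne'
  have hlo : ahMob w x y (bm - 1) ≤ bm := by
    have h1 := (abs_le.mp (hmob (bm - 1) (hbJ _ hmJ)).2.1).2; linarith
  have hhi : bp ≤ ahMob w x y (bp + 1) := by
    have h1 := (abs_le.mp (hmob (bp + 1) (hbJ _ hpJ)).2.1).1; linarith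
  have hpos : ∀ b ∈ Icc (bm - 1) (bp + 1), 0 ≤ ahMobD w x y b := fun b hb =>
    (hmob b (hbJ b hb)).2.2.2.le
  have hT := ahT_eq_integral_ahMob hτ h u hq hAx hAy hden hlo hhi hpos
  have hTy := ahTy_eq_setIntegral hτ w h u x y
  -- the two integrands on `J'`
  set f₁ : ℝ → ℝ := fun b => ahMobD w x y b *
    (u (ahG w b x y) * ((1 + w * h x * ahMob w x y b) * τ (ahMob w x y b))) with hf₁
  set f₂ : ℝ → ℝ := fun b => u (ahG w b x y) * ((1 + w * h y * b) * τ b) with hf₂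
  have hmG : Measurable fun b => u (ahG w b x y) := hum.comp (measurable_ahG_left w x y)
  have hmρ := measurable_ahMob w x y
  have hmρ' := measurable_ahMobD w x y
  have hm₁ : Measurable f₁ :=
    hmρ'.mul (hmG.mul ((measurable_const.add (measurable_const.mul hmρ)).mul (hτ.measurable.comp hmρ)))
  have hm₂ : Measurable f₂ :=
    hmG.mul ((measurable_const.add (measurable_const.mul measurable_id)).mul hτ.measurable)
  -- uniform bounds on `J'`
  have hρbd : ∀ b ∈ Icc (bm - 1) (bp + 1), |ahMob w x y b| ≤ B' + 1 := by
    intro b hb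
    have h1 := (hmob b (hbJ b hb)).2.1
    calc |ahMob w x y b| = |(ahMob w x y b - b) + b| := by ring_nf
      _ ≤ |ahMob w x y b - b| + |b| := abs_add_le _ _
      _ ≤ cρ * w + B' := add_le_add h1 (hbJ b hb)
      _ ≤ B' + 1 := by linarith
  have hρ'bd : ∀ b ∈ Icc (bm - 1) (bp + 1), |ahMobD w x y b| ≤ cρ' + 1 := by
    intro b hb
    have h1 := (hmob b (hbJ b hb)).2.2.1
    calc |ahMobD w x y b| = |(ahMobD w x y b - 1) + 1| := by ring_nf
      _ ≤ |ahMobD w x y b - 1| + |(1 : ℝ)| := abs_add_le _ _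
      _ ≤ cρ' * w + 1 := by rw [abs_one]; exact add_le_add h1 le_rfl
      _ ≤ cρ' + 1 := by nlinarith
  have hwgt : ∀ (c b : ℝ), |c| ≤ H → |b| ≤ B' + 1 → |1 + w * c * b| ≤ 2 := by
    intro c b hc hb
    have h1 : |w * c * b| ≤ 1 := by
      rw [abs_mul, abs_mul, abs_of_pos hw0]
      calc w * |c| * |b| ≤ w * H * (B' + 1) := by gcongr
        _ ≤ 1 := hwH
    calc |1 + w * c * b| ≤ |(1 : ℝ)| + |w * c * b| := abs_add_le _ _
      _ ≤ 1 + 1 := by rw [abs_one]; exact add_le_add le_rfl h1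
      _ = 2 := by norm_num
  have hbd₁ : ∀ b ∈ Icc (bm - 1) (bp + 1), |f₁ b| ≤ (cρ' + 1) * (M * (2 * Cτ)) := by
    intro b hb
    simp only [hf₁]
    rw [abs_mul, abs_mul, abs_mul, abs_of_nonneg (hu0 _)]
    refine mul_le_mul (hρ'bd b hb) ?_
      (mul_nonneg (hu0 _) (mul_nonneg (abs_nonneg _) (abs_nonneg _))) (by positivity)
    refine mul_le_mul (hM _) ?_ (by positivity) hM0
    exact mul_le_mul (hwgt _ _ (hH x) (hρbd b hb)) (hCτ _) (abs_nonneg _) zero_le_two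
  have hbd₂ : ∀ b ∈ Icc (bm - 1) (bp + 1), |f₂ b| ≤ M * (2 * Cτ) := by
    intro b hb
    simp only [hf₂]
    rw [abs_mul, abs_mul, abs_of_nonneg (hu0 _)]
    refine mul_le_mul (hM _) ?_ (by positivity) hM0
    exact mul_le_mul (hwgt _ _ (hH y) ((hbJ b hb).trans (by linarith))) (hCτ _) (abs_nonneg _)
      zero_le_two
  have hint₁ : IntegrableOn f₁ (Icc (bm - 1) (bp + 1)) := integrableOn_Icc_of_bound hm₁ hbd₁
  have hint₂ : IntegrableOn f₂ (Icc (bm - 1) (bp + 1)) := integrableOn_Icc_of_bound hm₂ hbd₂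
  -- `R_y u(x) = ∫_{J'} (f₁ - f₂)`
  have hR : ahRy τ w h y u x = ∫ b in Icc (bm - 1) (bp + 1), (f₁ b - f₂ b) := by
    rw [ahRy_apply, hT, hTy, ← integral_sub hint₁ hint₂]
  rw [hR]
  -- the majorant
  set CΔ := 2 * Cτ * cρ' + H * cρ * Cτ + Lh * c₃ * B' * Cτ + 2 * L * cρ with hCΔ
  have hCΔ0 : 0 ≤ CΔ := by rw [hCΔ]; positivity
  have hβm := measurable_ahBeta bm bp CΔ Cτ (cρ * w) w
  have hint₃ : IntegrableOn (fun b => u (ahG w b x y) * ahBeta bm bp CΔ Cτ (cρ * w) w b)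
      (Icc (bm - 1) (bp + 1)) := by
    refine integrableOn_Icc_of_bound (hmG.mul hβm) (C := M * (CΔ * w + 8 * Cτ)) fun b _ => ?_
    rw [abs_mul, abs_of_nonneg (hu0 _), abs_of_nonneg (ahBeta_nonneg (by positivity) hCτ0 b)]
    exact mul_le_mul (hM _) (ahBeta_le _ _ _ _ _ hCτ0 b) (ahBeta_nonneg (by positivity) hCτ0 b) hM0
  have hpt : ∀ b ∈ Icc (bm - 1) (bp + 1),
      ‖f₁ b - f₂ b‖ ≤ u (ahG w b x y) * ahBeta bm bp CΔ Cτ (cρ * w) w b := by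
    intro b hb
    obtain ⟨-, hρ, hρ', -⟩ := hmob b (hbJ b hb)
    have hTτ := tau_diff_bound hτ hL hL0 hCτ (by positivity : 0 ≤ cρ * w) hρ
    have hhxy : |h x - h y| ≤ Lh * c₃ * w := by
      calc |h x - h y| ≤ Lh * |x - y| := hLh x y
        _ ≤ Lh * (c₃ * w) := mul_le_mul_of_nonneg_left hxy hLh0
        _ = Lh * c₃ * w := by ring
    have hΔ := delta_bound hρ' hρ hhxy (hH x) (hH y) (hbJ b hb) (hτ.nonneg _)
      ((le_abs_self _).trans (hCτ _)) hTτ hw0.le hw1 hwH hcρw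
    have e : f₁ b - f₂ b = u (ahG w b x y) *
        (ahMobD w x y b * ((1 + w * h x * ahMob w x y b) * τ (ahMob w x y b)) -
          (1 + w * h y * b) * τ b) := by
      simp only [hf₁, hf₂]; ring
    rw [e, Real.norm_eq_abs, abs_mul, abs_of_nonneg (hu0 _)]
    refine mul_le_mul_of_nonneg_left (hΔ.trans (le_of_eq ?_)) (hu0 _)
    unfold ahBeta
    rw [hCΔ]
    ring
  calc |∫ b in Icc (bm - 1) (bp + 1), (f₁ b - f₂ b)|
      = ‖∫ b in Icc (bm - 1) (bp + 1), (f₁ b - f₂ b)‖ := (Real.norm_eq_abs _).symm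
    _ ≤ ∫ b in Icc (bm - 1) (bp + 1), ‖f₁ b - f₂ b‖ := norm_integral_le_integral_norm _
    _ ≤ ∫ b in Icc (bm - 1) (bp + 1), u (ahG w b x y) * ahBeta bm bp CΔ Cτ (cρ * w) w b :=
        setIntegral_mono_on (hint₁.sub hint₂).norm hint₃ measurableSet_Icc hpt

/-- `∫_{J'} 𝟙_{[a-r, a+r]} ≤ 2r`. [folklore] -/
theorem setIntegral_indicator_Icc_le (J : Set ℝ) (a : ℝ) {r : ℝ} (hr : 0 ≤ r) :
    ∫ b in J, (Icc (a - r) (a + r)).indicator (1 : ℝ → ℝ) b ≤ 2 * r := by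
  have hint : Integrable ((Icc (a - r) (a + r)).indicator (1 : ℝ → ℝ)) := by
    refine IntegrableOn.integrable_indicator ?_ measurableSet_Icc
    exact integrableOn_Icc_of_bound measurable_const (C := 1) fun b _ => by simp
  calc ∫ b in J, (Icc (a - r) (a + r)).indicator (1 : ℝ → ℝ) b
      ≤ ∫ b, (Icc (a - r) (a + r)).indicator (1 : ℝ → ℝ) b :=
        setIntegral_le_integral hint (ae_of_all _ fun b => Set.indicator_nonneg (fun _ _ => zero_le_one) b)
    _ = 2 * r := by
        rw [integral_indicator_one measurableSet_Icc, Real.volume_real_Icc_of_le (by linarith)]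
        ring

/-- `∫_{J'} β ≤ C_Δ w (b₊ - b₋ + 2) + 16 ‖τ‖_∞ r`. [folklore] -/
theorem setIntegral_ahBeta_le {bm bp : ℝ} (hbmp : bm < bp) (CΔ w : ℝ) {Cτ r : ℝ} (hCτ : 0 ≤ Cτ)
    (hr : 0 ≤ r) :
    ∫ b in Icc (bm - 1) (bp + 1), ahBeta bm bp CΔ Cτ r w b ≤
      CΔ * w * (bp - bm + 2) + 16 * Cτ * r := by
  unfold ahBeta
  have hI : ∀ a : ℝ, IntegrableOn (fun b => (Icc (a - r) (a + r)).indicator (1 : ℝ → ℝ) b)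
      (Icc (bm - 1) (bp + 1)) := fun a =>
    integrableOn_Icc_of_bound (measurable_one.indicator measurableSet_Icc) (C := 1) fun b _ => by
      have h0 : 0 ≤ (Icc (a - r) (a + r)).indicator (1 : ℝ → ℝ) b :=
        Set.indicator_nonneg (fun _ _ => zero_le_one) b
      have h1 : (Icc (a - r) (a + r)).indicator (1 : ℝ → ℝ) b ≤ 1 :=
        Set.indicator_le_self' (fun _ _ => zero_le_one) b
      rw [abs_of_nonneg h0]
      exact h1
  have hIc : IntegrableOn (fun _ : ℝ => CΔ * w) (Icc (bm - 1) (bp + 1)) :=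
    integrableOn_Icc_of_bound measurable_const (C := |CΔ * w|) fun b _ => le_rfl
  have hI2 : IntegrableOn (fun b => (Icc (bm - r) (bm + r)).indicator (1 : ℝ → ℝ) b +
      (Icc (bp - r) (bp + r)).indicator (1 : ℝ → ℝ) b) (Icc (bm - 1) (bp + 1)) :=
    (hI bm).add (hI bp)
  have hI3 : IntegrableOn (fun b => 4 * Cτ * ((Icc (bm - r) (bm + r)).indicator (1 : ℝ → ℝ) b +
      (Icc (bp - r) (bp + r)).indicator (1 : ℝ → ℝ) b)) (Icc (bm - 1) (bp + 1)) :=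
    hI2.const_mul (4 * Cτ)
  rw [integral_add hIc hI3, integral_const_mul (4 * Cτ), integral_add (hI bm) (hI bp),
    setIntegral_const, Real.volume_real_Icc_of_le (by linarith), smul_eq_mul]
  have h1 := setIntegral_indicator_Icc_le (Icc (bm - 1) (bp + 1)) bm hr
  have h2 := setIntegral_indicator_Icc_le (Icc (bm - 1) (bp + 1)) bp hr
  nlinarith

/-- `(x, b') ↦ u(g_{b'}(x,y)) β(b')` is integrable on `P × J'` for any bounded window `P` (bounded
measurable integrand, finite measure). [folklore] -/
theorem integrable_prod_ahG_ahBeta {u : ℝ → ℝ} (hum : Measurable u) (hu0 : ∀ z, 0 ≤ u z) {M : ℝ}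
    (hM : ∀ z, u z ≤ M) (w y bm bp CΔ r : ℝ) {Cτ : ℝ} (hCw : 0 ≤ CΔ * w) (hCτ : 0 ≤ Cτ) (P : Set ℝ)
    [IsFiniteMeasure (volume.restrict P)] :
    Integrable (Function.uncurry fun x b => u (ahG w b x y) * ahBeta bm bp CΔ Cτ r w b)
      ((volume.restrict P).prod (volume.restrict (Icc (bm - 1) (bp + 1)))) := by
  have hM0 : 0 ≤ M := (hu0 0).trans (hM 0)
  have hmeas : Measurable
      (Function.uncurry fun x b => u (ahG w b x y) * ahBeta bm bp CΔ Cτ r w b) := by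
    refine Measurable.mul ?_ ((measurable_ahBeta bm bp CΔ Cτ r w).comp measurable_snd)
    refine hum.comp ?_
    unfold ahG
    exact (measurable_fst.add_const _).add ((measurable_ahPhi_right w y).comp measurable_snd)
  refine Integrable.mono' (integrable_const (M * (CΔ * w + 8 * Cτ))) hmeas.aestronglyMeasurable
    (ae_of_all _ fun p => ?_)
  show ‖u (ahG w p.2 p.1 y) * ahBeta bm bp CΔ Cτ r w p.2‖ ≤ M * (CΔ * w + 8 * Cτ)
  rw [Real.norm_eq_abs, abs_mul, abs_of_nonneg (hu0 _), abs_of_nonneg (ahBeta_nonneg hCw hCτ _)]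
  exact mul_le_mul (hM _) (ahBeta_le _ _ _ _ _ hCτ _) (ahBeta_nonneg hCw hCτ _) hM0

/-- **Tonelli step**: `∫_{[y-1/2, y+1/2)} (∫_{J'} u(g_{b'}(x,y)) β(b') db') dx = ‖u‖₁ ∫_{J'} β`, since
`∫ u(x + ϑ + Φ(y,b')) dx = ‖u‖₁` over any period. [cite: AjankiHuveneers2011, proof of Lemma 5.4] -/
theorem integral_integral_ahG_ahBeta {u : ℝ → ℝ} (hup : Function.Periodic u 1) (hum : Measurable u)
    (hu0 : ∀ z, 0 ≤ u z) {M : ℝ} (hM : ∀ z, u z ≤ M) (w y bm bp CΔ r : ℝ) {Cτ : ℝ}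
    (hCw : 0 ≤ CΔ * w) (hCτ : 0 ≤ Cτ) :
    ∫ x in Ico (y - 1 / 2) (y - 1 / 2 + 1), ∫ b in Icc (bm - 1) (bp + 1),
        u (ahG w b x y) * ahBeta bm bp CΔ Cτ r w b =
      ahL1 u * ∫ b in Icc (bm - 1) (bp + 1), ahBeta bm bp CΔ Cτ r w b := by
  have hF := integrable_prod_ahG_ahBeta hum hu0 hM w y bm bp CΔ r hCw hCτ
    (Ico (y - 1 / 2) (y - 1 / 2 + 1))
  rw [integral_integral_swap hF]
  have hinner : ∀ b : ℝ, ∫ x in Ico (y - 1 / 2) (y - 1 / 2 + 1),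
      u (ahG w b x y) * ahBeta bm bp CΔ Cτ r w b = ahBeta bm bp CΔ Cτ r w b * ahL1 u := by
    intro b
    rw [integral_mul_const]
    have e : (fun x => u (ahG w b x y)) = fun x => u (x + (ahTheta w + ahPhi w y b)) := by
      funext x; unfold ahG; rw [add_assoc]
    rw [e, setIntegral_Ico_translate_eq_ahL1 hup hu0, mul_comm]
  simp_rw [hinner]
  rw [integral_mul_const, mul_comm]

/-- **(5.14) with explicit constants**: `‖R_y u‖₁ ≤ K' w ‖u‖₁`.
[cite: AjankiHuveneers2011, Lemma 5.4 eq. (5.14)] -/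
theorem ahRy_L1_bound {τ : ℝ → ℝ} {bm bp : ℝ} (hτ : ReducedLawHyp τ bm bp) {h : ℝ → ℝ}
    (hhp : Function.Periodic h 1)
    {H Lh : ℝ} (hH : ∀ x, |h x| ≤ H) (hLh : ∀ x y, |h x - h y| ≤ Lh * |x - y|) (hLh0 : 0 ≤ Lh)
    {Cτ : ℝ} (hCτ : ∀ s, |τ s| ≤ Cτ) (hCτ0 : 0 ≤ Cτ)
    {L : ℝ} (hL : ∀ b₁ ∈ Icc bm bp, ∀ b₂ ∈ Icc bm bp, |τ b₁ - τ b₂| ≤ L * |b₁ - b₂|) (hL0 : 0 ≤ L)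
    {K₁ K₂ w₁ : ℝ} (hK₁ : 0 < K₁)
    (hinc : ∀ w ∈ Set.Ioc 0 w₁, ∀ x, ∀ b ∈ Icc bm bp,
      K₁ * w ≤ ahStep w b x - x ∧ ahStep w b x - x ≤ K₂ * w)
    {K ε w w₂ cρ cρ' : ℝ} (hK : 0 < K) (hε : 0 < ε) (hcρ : 0 ≤ cρ) (hcρ' : 0 ≤ cρ')
    (hmob : ∀ w ∈ Ioc 0 w₂, ∀ x y : ℝ, ε ≤ |Real.sin (π * x)| → ε ≤ |Real.sin (π * y)| →
        |x - y| ≤ (K + K₂) * w → ∀ b : ℝ, |b| ≤ max |bm| |bp| + 1 →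
          π * w * ε ^ 2 / 2 ≤ ahSqrtQ w * ahNumSlope w x + ahMobC w x y * b ∧
          |ahMob w x y b - b| ≤ cρ * w ∧ |ahMobD w x y b - 1| ≤ cρ' * w ∧ 0 < ahMobD w x y b)
    (hw0 : 0 < w) (hw1 : w ≤ w₁) (hw2 : w ≤ w₂) (hw_one : w ≤ 1) (hcρw : cρ * w ≤ 1)
    (hwε : π * (K + K₂) * w ≤ ε) (hKw : (K + K₂) * w ≤ 1 / 2)
    (hwH : w * H * (max |bm| |bp| + 1 + 1) ≤ 1) (hwq : π * w ≤ 1 / 2)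
    {y : ℝ} (hy : ∀ k : ℤ, ε ≤ |y - k|) {u : ℝ → ℝ} (hu : AHBallFn u y (K * w)) :
    ahL1 (ahRy τ w h y u) ≤
      ((2 * Cτ * cρ' + H * cρ * Cτ + Lh * (K + K₂) * (max |bm| |bp| + 1) * Cτ + 2 * L * cρ) *
          (bp - bm + 2) + 16 * Cτ * cρ) * w * ahL1 u := by
  obtain ⟨M, hM⟩ := hu.bounded
  have hK₂ : 0 < K₂ := by
    obtain ⟨h1, h2⟩ := hinc w ⟨hw0, hw1⟩ 0 bm ⟨le_rfl, hτ.lt.le⟩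
    have : K₁ * w ≤ K₂ * w := h1.trans h2
    exact lt_of_lt_of_le hK₁ (le_of_mul_le_mul_right this hw0)
  have hc₃ : 0 ≤ K + K₂ := by positivity
  have hSy2 : 2 * ε ≤ |Real.sin (π * y)| := two_mul_le_abs_sin_pi hy
  have hSy : ε ≤ |Real.sin (π * y)| := by linarith
  set CΔ := 2 * Cτ * cρ' + H * cρ * Cτ + Lh * (K + K₂) * (max |bm| |bp| + 1) * Cτ + 2 * L * cρ
    with hCΔ
  have hB0 : 0 ≤ max |bm| |bp| := le_max_of_le_left (abs_nonneg _)
  have hH0 : 0 ≤ H := (abs_nonneg _).trans (hH 0)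
  have hCΔ0 : 0 ≤ CΔ := by rw [hCΔ]; positivity
  -- Step A: the pointwise bound on the period window `P = [y - 1/2, y + 1/2)`
  have hptP : ∀ x ∈ Ico (y - 1 / 2) (y - 1 / 2 + 1), |ahRy τ w h y u x| ≤
      ∫ b in Icc (bm - 1) (bp + 1), u (ahG w b x y) * ahBeta bm bp CΔ Cτ (cρ * w) w b := by
    intro x hx
    by_cases hR : ahRy τ w h y u x = 0
    · rw [hR, abs_zero]
      exact setIntegral_nonneg measurableSet_Icc fun b _ =>
        mul_nonneg (hu.nonneg _) (ahBeta_nonneg (by positivity) hCτ0 b)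
    have hTT : ahT τ w h u x ≠ 0 ∨ ahTy τ w h y u x ≠ 0 := by
      by_contra hcon
      push Not at hcon
      apply hR
      rw [ahRy_apply, hcon.1, hcon.2, sub_zero]
    have hk : ∃ k : ℤ, |x - y - k| < (K + K₂) * w := by
      rcases hTT with hT | hT
      · obtain ⟨b₀, hb₀, hne⟩ := exists_ne_zero_of_ahT_ne_zero hτ.eq_zero hT
        obtain ⟨k, hk⟩ := hu.support _ hne
        obtain ⟨hlo, hhi⟩ := hinc w ⟨hw0, hw1⟩ x b₀ hb₀
        refine ⟨k, ?_⟩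
        have e : x - y - k = (ahStep w b₀ x - y - k) - (ahStep w b₀ x - x) := by ring
        rw [e]
        have h2 := abs_lt.mp hk
        have h3 : 0 ≤ ahStep w b₀ x - x := le_trans (by positivity) hlo
        rw [abs_lt]; constructor <;> linarith
      · obtain ⟨b₀, hb₀, hne⟩ := exists_ne_zero_of_ahTy_ne_zero hτ.eq_zero hT
        obtain ⟨k, hk⟩ := hu.support _ hne
        obtain ⟨hlo, hhi⟩ := hinc w ⟨hw0, hw1⟩ y b₀ hb₀
        have hG := ahG_sub w b₀ x y
        refine ⟨k, ?_⟩
        have e : x - y - k = (ahG w b₀ x y - y - k) - (ahG w b₀ x y - x) := by ring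
        rw [e, hG]
        have h2 := abs_lt.mp hk
        have h3 : 0 ≤ ahStep w b₀ y - y := le_trans (by positivity) hlo
        rw [abs_lt]; constructor <;> linarith
    obtain ⟨k, hk⟩ := hk
    have hk0 : k = 0 := by
      have hxy' : |x - y| ≤ 1 / 2 := abs_le.mpr ⟨by linarith [hx.1], by linarith [hx.2]⟩
      have h1 : |(k : ℝ)| < 1 := by
        calc |(k : ℝ)| = |(x - y) - (x - y - k)| := by ring_nf
          _ ≤ |x - y| + |x - y - k| := abs_sub _ _
          _ < 1 / 2 + 1 / 2 := add_lt_add_of_le_of_lt hxy' (lt_of_lt_of_le hk hKw)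
          _ = 1 := by norm_num
      have h2 : |k| < 1 := by exact_mod_cast h1
      exact Int.abs_lt_one_iff.mp h2
    rw [hk0, Int.cast_zero, sub_zero] at hk
    have hxy : |x - y| ≤ (K + K₂) * w := hk.le
    have hSx : ε ≤ |Real.sin (π * x)| := by
      have h1 := Real.abs_sin_sub_sin_le (π * x) (π * y)
      have h2 : |π * x - π * y| ≤ ε := by
        rw [← mul_sub, abs_mul, abs_of_pos Real.pi_pos]
        calc π * |x - y| ≤ π * ((K + K₂) * w) := mul_le_mul_of_nonneg_left hxy Real.pi_pos.le
          _ = π * (K + K₂) * w := by ring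
          _ ≤ ε := hwε
      have h3 := abs_sub_abs_le_abs_sub (Real.sin (π * y)) (Real.sin (π * x))
      rw [abs_sub_comm] at h3
      linarith
    exact ahRy_pointwise_bound hτ hH hLh hLh0 hCτ hCτ0 hL hL0 hε hc₃ hcρ hcρ' hw0 hw_one hcρw
      hwH hwq hSx hSy hxy (hmob w ⟨hw0, hw2⟩ x y hSx hSy hxy) hu.measurable hu.nonneg hM
  -- Step B: integrate over the period and exchange the integrals
  have hRper := ahRy_periodic (τ := τ) (w := w) y hu.periodic hhp
  have hper : Function.Periodic (fun x => |ahRy τ w h y u x|) 1 := fun x => by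
    show |ahRy τ w h y u (x + 1)| = |ahRy τ w h y u x|
    rw [hRper x]
  have hF := integrable_prod_ahG_ahBeta hu.measurable hu.nonneg hM w y bm bp CΔ (cρ * w)
    (by positivity : 0 ≤ CΔ * w) hCτ0 (Ico (y - 1 / 2) (y - 1 / 2 + 1))
  calc ahL1 (ahRy τ w h y u) = ∫ x in Ico (y - 1 / 2) (y - 1 / 2 + 1), |ahRy τ w h y u x| := by
        unfold ahL1; exact (periodic_setIntegral_Ico hper (y - 1 / 2)).symm
    _ ≤ ∫ x in Ico (y - 1 / 2) (y - 1 / 2 + 1), ∫ b in Icc (bm - 1) (bp + 1),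
          u (ahG w b x y) * ahBeta bm bp CΔ Cτ (cρ * w) w b := by
        refine integral_mono_of_nonneg (ae_of_all _ fun x => abs_nonneg _) hF.integral_prod_left ?_
        exact ae_restrict_of_forall_mem measurableSet_Ico hptP
    _ = ahL1 u * ∫ b in Icc (bm - 1) (bp + 1), ahBeta bm bp CΔ Cτ (cρ * w) w b :=
        integral_integral_ahG_ahBeta hu.periodic hu.measurable hu.nonneg hM w y bm bp CΔ (cρ * w)
          (by positivity) hCτ0
    _ ≤ ahL1 u * (CΔ * w * (bp - bm + 2) + 16 * Cτ * (cρ * w)) :=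
        mul_le_mul_of_nonneg_left (setIntegral_ahBeta_le hτ.lt CΔ w hCτ0 (by positivity))
          (ahL1_nonneg u)
    _ = (CΔ * (bp - bm + 2) + 16 * Cτ * cρ) * w * ahL1 u := by ring

end Literature.Barriers.AtomisticToContinuum.HeatConduction

namespace Literature.Barriers.AtomisticToContinuum

open HeatConduction

/-- **Lemma 5.4 of Ajanki–Huveneers, eqs. (5.14)–(5.15), discharged**: for `K, ε > 0` there are
`w₀, K' > 0` (depending on `K`, `ε`, `h` and the reduced law) such that for `w ∈ (0, w₀]`,
`|y|_𝕋 ≥ ε` and `u ∈ L¹_{B(y,Kw)}(𝕋; ℝ₊)` (bounded Borel representatives),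
`‖R_y u‖₁ ≤ K' w ‖u‖₁` and `‖Tu‖_∞ ≤ K' w⁻¹ ‖u‖₁`. [cite: AjankiHuveneers2011, Lemma 5.4 eqs. (5.14)-(5.15)] -/
theorem AjankiHuveneers2011_RyL1Estimate_holds : AjankiHuveneers2011_RyL1Estimate := by
  intro τ bm bp hτ h hhp hhd K hK ε hε
  obtain ⟨Cτ, hCτ0, hCτ⟩ := hτ.exists_bound
  obtain ⟨L, hL0, hL⟩ := hτ.exists_lipschitz
  obtain ⟨H, Lh, hH0, hLh0, hH, hLh⟩ := periodic_contDiff_bounds hhp hhd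
  obtain ⟨w₁, hw₁, K₁, K₂, hK₁, hK₁₂, hinc⟩ := ahStep_increment_linear hτ
  have hK₂ : 0 < K₂ := lt_of_lt_of_le hK₁ hK₁₂
  have hB0 : 0 ≤ max |bm| |bp| := le_max_of_le_left (abs_nonneg _)
  obtain ⟨w₂, hw₂, cρ, hcρ, cρ', hcρ', hmob⟩ :=
    ahMob_bounds (c₃ := K + K₂) (B' := max |bm| |bp| + 1) hε (by positivity) (by positivity)
  have hπ := Real.pi_pos
  have hbmp := hτ.lt
  refine ⟨min (min (min w₁ w₂) (min 1 (1 / (cρ + 1))))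
      (min (min (ε / (π * (K + K₂ + 1))) (1 / (2 * (K + K₂) + 1)))
        (min (1 / (2 * π * (max |bm| |bp| + 2))) (1 / ((H + 1) * (max |bm| |bp| + 2))))),
    by positivity, ?_⟩
  obtain ⟨C₁₄, hC₁₄⟩ : ∃ C : ℝ, C = (2 * Cτ * cρ' + H * cρ * Cτ +
      Lh * (K + K₂) * (max |bm| |bp| + 1) * Cτ + 2 * L * cρ) * (bp - bm + 2) + 16 * Cτ * cρ :=
    ⟨_, rfl⟩
  have hC₁₄0 : 0 ≤ C₁₄ := by
    have : 0 < bp - bm + 2 := by linarith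
    rw [hC₁₄]; positivity
  obtain ⟨K', hK'⟩ : ∃ K' : ℝ, K' = max (6 * Cτ / ε ^ 2) C₁₄ + 1 := ⟨_, rfl⟩
  have hK'1 : 6 * Cτ / ε ^ 2 ≤ K' := by rw [hK']; linarith [le_max_left (6 * Cτ / ε ^ 2) C₁₄]
  have hK'2 : C₁₄ ≤ K' := by rw [hK']; linarith [le_max_right (6 * Cτ / ε ^ 2) C₁₄]
  have hK'0 : 0 < K' := by rw [hK']; linarith [le_max_right (6 * Cτ / ε ^ 2) C₁₄]
  refine ⟨K', hK'0, ?_⟩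
  intro w hw y hy u hu
  obtain ⟨hw0, hwle⟩ := hw
  have ha : w ≤ w₁ :=
    hwle.trans ((min_le_left _ _).trans ((min_le_left _ _).trans (min_le_left _ _)))
  have hb : w ≤ w₂ :=
    hwle.trans ((min_le_left _ _).trans ((min_le_left _ _).trans (min_le_right _ _)))
  have hc : w ≤ 1 :=
    hwle.trans ((min_le_left _ _).trans ((min_le_right _ _).trans (min_le_left _ _)))
  have hd : w ≤ 1 / (cρ + 1) :=
    hwle.trans ((min_le_left _ _).trans ((min_le_right _ _).trans (min_le_right _ _)))
  have he : w ≤ ε / (π * (K + K₂ + 1)) :=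
    hwle.trans ((min_le_right _ _).trans ((min_le_left _ _).trans (min_le_left _ _)))
  have hf : w ≤ 1 / (2 * (K + K₂) + 1) :=
    hwle.trans ((min_le_right _ _).trans ((min_le_left _ _).trans (min_le_right _ _)))
  have hg : w ≤ 1 / (2 * π * (max |bm| |bp| + 2)) :=
    hwle.trans ((min_le_right _ _).trans ((min_le_right _ _).trans (min_le_left _ _)))
  have hh : w ≤ 1 / ((H + 1) * (max |bm| |bp| + 2)) :=
    hwle.trans ((min_le_right _ _).trans ((min_le_right _ _).trans (min_le_right _ _)))
  have hπw : 0 ≤ π * w := by positivity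
  -- derived smallness facts
  have hwB : 0 ≤ w * max |bm| |bp| := mul_nonneg hw0.le hB0
  have hwHn : 0 ≤ w * H := mul_nonneg hw0.le hH0
  have hcρw : cρ * w ≤ 1 := by
    have := (le_div_iff₀ (by positivity)).mp hd
    linarith
  have hwε : π * (K + K₂) * w ≤ ε := by
    have := (le_div_iff₀ (by positivity)).mp he
    linarith
  have hKw : (K + K₂) * w ≤ 1 / 2 := by
    have := (le_div_iff₀ (by positivity)).mp hf
    linarith
  have hwq' : π * w * (max |bm| |bp| + 2) ≤ 1 / 2 := by
    have := (le_div_iff₀ (by positivity)).mp hg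
    linarith
  have hwq : π * w ≤ 1 / 2 := by
    have : π * w * 1 ≤ π * w * (max |bm| |bp| + 2) :=
      mul_le_mul_of_nonneg_left (by linarith) hπw
    linarith
  have hwb : π * w * (1 + max |bm| |bp|) ≤ 1 / 2 := by
    have : π * w * (1 + max |bm| |bp|) ≤ π * w * (max |bm| |bp| + 2) :=
      mul_le_mul_of_nonneg_left (by linarith) hπw
    linarith
  have hwHB : w * (H + 1) * (max |bm| |bp| + 2) ≤ 1 := by
    have := (le_div_iff₀ (by positivity)).mp hh
    linarith
  have hwH1 : w * H * max |bm| |bp| ≤ 1 := by linarith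
  have hwH2 : w * H * (max |bm| |bp| + 1 + 1) ≤ 1 := by linarith
  have hL1 := ahL1_nonneg u
  constructor
  · have h14 := ahRy_L1_bound hτ hhp hH hLh hLh0 hCτ hCτ0 hL hL0 hK₁ hinc hK hε hcρ hcρ' hmob
      hw0 ha hb hc hcρw hwε hKw hwH2 hwq hy hu
    rw [← hC₁₄] at h14
    calc ahL1 (ahRy τ w h y u) ≤ C₁₄ * w * ahL1 u := h14
      _ ≤ K' * w * ahL1 u :=
          mul_le_mul_of_nonneg_right (mul_le_mul_of_nonneg_right hK'2 hw0.le) hL1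
  · intro x
    have h15 := ahT_sup_bound hτ hH hCτ hCτ0 hK₁ hinc hε hw0 ha hwε hwb hwH1 hy hu x
    calc |ahT τ w h u x| ≤ 6 * Cτ / ε ^ 2 * w⁻¹ * ahL1 u := h15
      _ ≤ K' * w⁻¹ * ahL1 u :=
          mul_le_mul_of_nonneg_right (mul_le_mul_of_nonneg_right hK'1 (inv_nonneg.mpr hw0.le)) hL1

end Literature.Barriers.AtomisticToContinuum

end
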